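import Mathlib
import Literature.MathematicalPhysics.QuantumFieldTheory.Balaban1983to89.B14
import Literature.MathematicalPhysics.QuantumFieldTheory.Balaban1983to89.B14Thm2

/-!
# `Balaban1983to89.B14Sect3` — [Balaban1988Convergent] Sect. 3 (pp. 264–285; printed title, p. 264: "3. The k+1-st
Renormalization Transformation and the Proof of Theorem 2"): displayed scalar chains typed VERBATIM, and the printed
internal steps that are pure algebra / calculus KERNEL-CHECKED

CITATION HEADER (lean-in-tree rule 2026-08-18).  Source: T. Bałaban, *Convergent renormalization expansions for lattice
gauge theories*, Commun. Math. Phys. **119**, 243–285 (1988), doi:10.1007/bf01217741 (cell paper B14; held: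
`paper:balaban1988-cmp119-convergent-renormalization`; journal page = PDF page + 242; every quotation below was read
from the page renders `…-p022-x2.png` … `…-p043-x2.png`, the OCR layer being used for orientation only).  Companion
modules: `…B14` (the inductive description of Sect. 2, Theorems 1, 2, Cor. 3, the Theorem of p. 245), `…B14Thm2`
((2.43)/(2.44) named `Ineq243`/`Ineq244`, the summations of pp. 263–264).  This module reads the PROOF section.

WHAT IS REPRODUCED.  Sect. 3 is 22 pages of construction (block-spin transformation (3.1)–(3.6), conditional integrals
(3.23)–(3.33), the resolvent / random-walk representation (3.34)–(3.43), cluster expansions (3.44)–(3.47) by reference to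
[I] = [Balaban1987RG1] Sects. 3–7, and the proof of Theorem 2 (3.48)–(3.67) with a sketched second proof (3.68)–(3.70)).
Almost all of it is stated BY REFERENCE — p. 275 [PDF 33], verbatim: *"To construct their cluster expansions we repeat
all the considerations of Sect. 3.7 [I], with minor changes connected with the boundary layers {Ω_j∖Ω_{j+1}}, and
additions connected with the new terms in the effective action. We describe here briefly these changes and additions
only."* (the printed "Sect. 3.7 [I]" = Sects. 3–7 of [I]) — and is recorded clause by clause in the cell's reader census
(GAPS.md rows G-B14s-02 … G-B14s-21, C-B14s-01 … C-B14s-06).  What a kernel CAN adjudicate in it is typed here: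
* the displayed SCALAR CHAINS (3.7), (3.8), (3.14), (3.19), (3.68) — first member quoted as a hypothesis (it is the cited
  input "(1.65) [14]" resp. the preceding construction), the remaining members PROVED from the explicit restrictions the
  print calls "for A₁/A₀ and γ sufficiently small" (`ineq37_scalar`, `ineq37_conclusion`, `ineq38_scalar`,
  `ineq38_conclusion`, `ineq314_of`, `ineq319_scalar`, `ineq368_corrected`); and "O(1)ε_k exp(−R_k), hence by any
  positive power of g_k" (p. 269, after (3.22), verbatim) as `exp_neg_R_le_pow`;
* (3.36)/(3.37): the integral representation of `−½ log det (C*Δ^{(k)}C)` — its 1×1 instance is COMPUTED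
  (`integral_resolvent_scalar`): the printed sign "+½∫₀^∞" is an erratum (`logdet_scalar_336_printed_sign_fails`), the
  identity holds with "−½∫" (`logdet_scalar_336_corrected`); harmless for the paper, which only bounds the bracket of
  (3.37) in absolute value (p. 280) — cell DIVERGENCE.md D-pv02.5; (3.35) first resolvent identity as ring algebra
  (`resolvent_identity_335`);
* (3.40): the tent functions `h` form a partition of unity, `Σ_{z∈Z^d} h(x − Mz) = 1` — one-dimensional factor
  (`tent_partition_unity`; the d-dimensional statement is the product);
* p. 280: "O(1) exp(−κ(LʲL⁻ⁿ)⁻¹) … ≤ O(1)(LʲL⁻ⁿ)⁵" — `exp_neg_mul_le_pow_inv`, `exp_neg_inv_le_pow_five` (explicit O(1) =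
  (5/κ)⁵e⁻⁵); (3.48) from (I.1.18) as `exp_split_348`;
* (3.49) + (3.55) ⇒ (3.56): the antisymmetrization of `Σ tr ∂^s E^{(s)} Π M` over the two index pairs, for ANY dimension,
  as the finite-sum identity `sum_antisymm_two_pairs` (with `sum_antisymm_pair`); (3.52)–(3.54) ⇒ (3.51): "because A is an
  arbitrary matrix" = `antisymm_of_pairing_symm_zero`; (3.53): the gauge function λ — its forward difference is computed
  (`fwdDiff_lam353`): the printed linear coefficient 1 does NOT give "(∂_μλ)(x) = Σ_κ A_{μκ}(x_κ − z_κ)", the coefficient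
  ξ/2 does (`fwdDiff_lam353_half`, `fwdDiff_lam353_printed_fails`; harmless: only the existence of such a λ is used —
  D-pv02.7);
* (3.60) ⇒ (3.61): a rank-4 tensor invariant under the axis reflections and the coordinate permutations is
  `c·δ_{μν}δ_{κλ}` on `κ<μ, λ<ν` (`invariant_tensor_361`, from `refl_invariant_vanish` + `perm_invariant_diag`); (3.62) first
  equality (`beta_resum_362`, given as hypotheses the vanishing of Σ_x and of Σ_y of Π^{(j)}_{22}(x, y, 0) — our reading of
  the print's *"Using the translation invariance and the identity (I.4.15) again"* (p. 282), i.e. of the first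
  Ward–Takahashi identity (4.15) of [I]; the marginal statement itself is not a printed sentence);
* (3.67) ⇒ (2.43) ("Summing over z ∈ Λ_j⁰∩Ω w̲ get the inequality (2.43) in Theorem 2 (with 1 − β, β > 0, instead of
  β < 1)", p. 283) and p. 283 last paragraph ⇒ (2.44): the point-counting summation `pointSum_le`, landing EXACTLY in the
  cell's `B14Thm2.Ineq243` / `B14Thm2.Ineq244` under the explicit representation hypotheses `Rep367` / `Rep244`
  (`ineq243_of_rep367`, `ineq244_of_rep244`).  NB for GAPS.md G-pv01-1(ii): p. 283 bounds the 𝐑-differences PER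
  LOCALIZATION DOMAIN X ("all the terms on the right-hand side can be bounded by O(1)(LʲL⁻ⁿ)⁴g_j^{κ₀}exp(−κd_j(X))"),
  i.e. the printed proof of (2.44) is termwise.
WHAT IS *NOT* REPRODUCED OR ASSERTED: any statement about the actual fields, operators, analyticity domains or
expansions of Sect. 3 — in particular (3.7)₁ (the bound on H_{k,□} obtained, p. 266, *"by an application of the
inequality (1.65) from [14], or rather by an application of the reasoning leading to that inequality"*), the
existence/analyticity of the multi-domain minimizers (3.10)–(3.11) (p. 266: *"as in [16]"*, *"This minimum is given by
V^{(k)} = M^k(U_{k+1}), where the minimal configuration U_{k+1} is determined by the sequence of domains"* — G-B14s-06),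
(3.22)'s bound (p. 269: H^{(k)} *"bounded on the set S_{k+1} by O(1)ε_k exp(−R_k)"*), the identities (3.26)–(3.33) (routine
finite-dimensional calculus, certified by hand in GAPS.md C-B14s-02, not typed: they live on the configuration spaces),
the lower bound λ₀ on spec C*Δ^{(k)}C (p. 273, uncited — G-B14s-11), everything done by reference to Sects. 3–7 of [I]
*"with minor changes"* (pp. 275–283 — G-B14s-12 … G-B14s-19), the Ward–Takahashi input (I.4.15), and (3.67) itself.  They enter, if at all, as explicit hypotheses (`Rep367`, first members of the chains).
NOTHING of the series is asserted; value = typed skeleton + located gaps + two print errata settled by computation, NOT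
summit progress.  Unit `b2b-balaban-pv02` (surge node prover #02, claim P14 Sects. 1+3); companion rows: cell `GAPS.md`
G-B14s-nn / C-B14s-nn, `DIVERGENCE.md` D-pv02.1–D-pv02.11, `SMALLNESS.md` §3 S-B14.17ff.
Revision v3 (gen 3, GAPS.md G-pv21-3): docstring-only — six header / docstring sites that carried paraphrases inside
quotation marks re-quoted VERBATIM from the renders p022/p023/p024/p027/p033/p040 (section title p. 264; p. 275;
p. 269 "hence by any positive power of g_k"; (3.62)'s use of (I.4.15); (3.9)/δ_k pp. 265–266; p. 266 "Thus χ_k(□) = 1"),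
plus three further header paraphrases found on self-audit (pp. 266, 269, 275); no declaration changed.
Revision v4 (gen 24, GAPS.md C-adv5-92 (b) / C-pv02g24-2): ADDITIVE — the chain (3.7) re-typed ALSO with the two
numerical coefficients of its first member as parameters `(c, c′)` (`ineq37_coeff_scalar`, `ineq37_coeff_conclusion`;
the printed chain is the instance `(4, 30d²L²)`, `ineq37_conclusion_of_coeff`), because an adversarial reading located
that the printed «4δ_k» is not supported on the bonds `b₀(c)` of `Γ_k` (there a `d`, `L`-dependent coefficient appears);
the conclusion `|H_{k,□}| < ε_k/10` is insensitive to the coefficient once `A₁/A₀` is chosen after `d`, `L`.  Every v3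
declaration is byte-identical; nothing printed is re-worded.  v4.1 (XREAD GAPS.md C-pv04g24-4, DOCFIX D-1): two
docstring sentences now say «c(d,L) ≥ … to leading order» (the objection's own form); no declaration changed.
-/

open Finset Real Set Filter MeasureTheory Topology

namespace Literature.MathematicalPhysics.QuantumFieldTheory.Balaban1983to89.B14Sect3

open Literature.MathematicalPhysics.QuantumFieldTheory.Balaban1983to89

/-! ## A. Displayed scalar chains of Sect. 3, typed verbatim (first member = hypothesis, rest = restrictions) -/

section ScalarChains

/-- **(3.7)**, verbatim (p. 266 [PDF 24]): *"|H_{k,□}|, |∇^η_{U_{k+1,□′}} H_{k,□}| ≦ B₃(4δ_k + exp(−δ2M₂R_k)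
30d²L²B₃(1+β₀)ε_k) < (4B₃ A₁/A₀ + 30d²L²B₃²(1+β₀) exp(−R_k)) ε_k < (1/10) ε_k on □̃, (3.7) for A₁/A₀ and γ
sufficiently small."*  The first member rests on the preceding sentence: *"On almost the whole cube □̃⁴, except a
boundary layer of the width 2M₁, the field in the argument of the function H_{k,□} is equal to (1/i) log[V_k(V_{□′}^{(k)})⁻¹],
hence it can be bounded by 4δ_k. On the boundary layer this field can be bounded by 30d²L²B₃(1+β₀)ε_k by an application
of the inequality (1.65) from [14], or rather by an application of the reasoning leading to that inequality. By the
exponential decay property (190) [15] we obtain the estimate"* — a cited METHOD, not a statement (cell GAPS.md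
G-B14s-05); it is a HYPOTHESIS below.  Typed reading for ONE real number `h` (either left-hand side at a point of □̃);
`δk = δ_k`, `εk = ε_k`, `Rk = R_k`; the printed "δ2M₂R_k" is `2·δ·M₂·R_k`. [cite: Balaban1988Convergent, (3.7) p.266] -/
def Ineq37Printed (h B₃ δk δ M₂ Rk d L β₀ εk A₀ A₁ : ℝ) : Prop :=
  h ≤ B₃ * (4 * δk + Real.exp (-(2 * δ * M₂ * Rk)) * (30 * d ^ 2 * L ^ 2 * B₃ * (1 + β₀) * εk)) ∧
  B₃ * (4 * δk + Real.exp (-(2 * δ * M₂ * Rk)) * (30 * d ^ 2 * L ^ 2 * B₃ * (1 + β₀) * εk))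
    < (4 * B₃ * A₁ / A₀ + 30 * d ^ 2 * L ^ 2 * B₃ ^ 2 * (1 + β₀) * Real.exp (-Rk)) * εk ∧
  (4 * B₃ * A₁ / A₀ + 30 * d ^ 2 * L ^ 2 * B₃ ^ 2 * (1 + β₀) * Real.exp (-Rk)) * εk < (1/10) * εk

/-- (3.7), scalar part: with `δ_k = (A₁/A₀) ε_k` (p. 265, after (3.4): *"δ_k = g_kA₁/A₀p₀(g_k)"*, and ε_k = g_kp₀(g_k)
by (2.4); cf. (3.9), p. 266, middle member elided: *"|V_k(y,x) − 1| = … < O(1)δ_k = O(1)(A₁/A₀)ε_k < ε_k"*) and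
`2δM₂ ≥ 1`, the middle member majorises the first bracket (with `≤`; the print has `<`), and the last `<` IS the
restriction `h10` ("for A₁/A₀ and γ sufficiently small"; cell SMALLNESS.md S-B14.17). [folklore] -/
theorem ineq37_scalar (B₃ A₀ A₁ δ M₂ R ε δk β₀ d L : ℝ) (hB : 0 ≤ B₃) (hε : 0 < ε) (hβ : 0 ≤ 1 + β₀)
    (hδk : δk = A₁ / A₀ * ε) (hM : 1 ≤ 2 * δ * M₂) (hR : 0 ≤ R)
    (h10 : 4 * B₃ * A₁ / A₀ + 30 * d ^ 2 * L ^ 2 * B₃ ^ 2 * (1 + β₀) * Real.exp (-R) < 1/10) :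
    B₃ * (4 * δk + Real.exp (-(2 * δ * M₂ * R)) * (30 * d ^ 2 * L ^ 2 * B₃ * (1 + β₀) * ε))
      ≤ (4 * B₃ * A₁ / A₀ + 30 * d ^ 2 * L ^ 2 * B₃ ^ 2 * (1 + β₀) * Real.exp (-R)) * ε
    ∧ (4 * B₃ * A₁ / A₀ + 30 * d ^ 2 * L ^ 2 * B₃ ^ 2 * (1 + β₀) * Real.exp (-R)) * ε < (1/10) * ε := by
  constructor
  · have hexp : Real.exp (-(2 * δ * M₂ * R)) ≤ Real.exp (-R) := by
      apply Real.exp_le_exp.mpr; nlinarith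
    have hc : 0 ≤ 30 * d ^ 2 * L ^ 2 * B₃ * (1 + β₀) * ε := by positivity
    rw [hδk]
    have e1 : B₃ * (4 * (A₁ / A₀ * ε) + Real.exp (-(2 * δ * M₂ * R)) * (30 * d ^ 2 * L ^ 2 * B₃ * (1 + β₀) * ε))
        = 4 * B₃ * A₁ / A₀ * ε + (B₃ * (30 * d ^ 2 * L ^ 2 * B₃ * (1 + β₀) * ε)) * Real.exp (-(2 * δ * M₂ * R)) := by
      ring
    have e2 : (4 * B₃ * A₁ / A₀ + 30 * d ^ 2 * L ^ 2 * B₃ ^ 2 * (1 + β₀) * Real.exp (-R)) * ε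
        = 4 * B₃ * A₁ / A₀ * ε + (B₃ * (30 * d ^ 2 * L ^ 2 * B₃ * (1 + β₀) * ε)) * Real.exp (-R) := by
      ring
    rw [e1, e2]
    linarith [mul_le_mul_of_nonneg_left hexp (mul_nonneg hB hc)]
  · exact mul_lt_mul_of_pos_right h10 hε

/-- (3.7) assembled: the first printed member (cited input) and the restrictions give the conclusion that is USED,
`|H_{k,□}| < (1/10) ε_k`. [folklore] -/
theorem ineq37_conclusion (h B₃ A₀ A₁ δ M₂ R ε δk β₀ d L : ℝ) (hB : 0 ≤ B₃) (hε : 0 < ε) (hβ : 0 ≤ 1 + β₀)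
    (hδk : δk = A₁ / A₀ * ε) (hM : 1 ≤ 2 * δ * M₂) (hR : 0 ≤ R)
    (h10 : 4 * B₃ * A₁ / A₀ + 30 * d ^ 2 * L ^ 2 * B₃ ^ 2 * (1 + β₀) * Real.exp (-R) < 1/10)
    (hfirst : h ≤ B₃ * (4 * δk + Real.exp (-(2 * δ * M₂ * R)) * (30 * d ^ 2 * L ^ 2 * B₃ * (1 + β₀) * ε))) :
    h < (1/10) * ε := by
  obtain ⟨h1, h2⟩ := ineq37_scalar B₃ A₀ A₁ δ M₂ R ε δk β₀ d L hB hε hβ hδk hM hR h10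
  linarith

/-- The chain (3.7) EXACTLY AS PRINTED (both `<` strict) holds given its first member, `δ_k = (A₁/A₀)ε_k`, the
strict forms `2δM₂ > 1`, `R_k > 0`, `B₃, d, L, 1+β₀ > 0`, and the restriction `h10`. [folklore] -/
theorem ineq37Printed_of_first (h B₃ A₀ A₁ δ M₂ R ε δk β₀ d L : ℝ) (hB : 0 < B₃) (hε : 0 < ε) (hβ : 0 < 1 + β₀)
    (hd : 0 < d) (hL : 0 < L) (hδk : δk = A₁ / A₀ * ε) (hM : 1 < 2 * δ * M₂) (hR : 0 < R)
    (h10 : 4 * B₃ * A₁ / A₀ + 30 * d ^ 2 * L ^ 2 * B₃ ^ 2 * (1 + β₀) * Real.exp (-R) < 1/10)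
    (hfirst : h ≤ B₃ * (4 * δk + Real.exp (-(2 * δ * M₂ * R)) * (30 * d ^ 2 * L ^ 2 * B₃ * (1 + β₀) * ε))) :
    Ineq37Printed h B₃ δk δ M₂ R d L β₀ ε A₀ A₁ := by
  refine ⟨hfirst, ?_, mul_lt_mul_of_pos_right h10 hε⟩
  have hexp : Real.exp (-(2 * δ * M₂ * R)) < Real.exp (-R) := by
    apply Real.exp_lt_exp.mpr; nlinarith
  have hc : 0 < 30 * d ^ 2 * L ^ 2 * B₃ * (1 + β₀) * ε := by positivity
  rw [hδk]
  have e1 : B₃ * (4 * (A₁ / A₀ * ε) + Real.exp (-(2 * δ * M₂ * R)) * (30 * d ^ 2 * L ^ 2 * B₃ * (1 + β₀) * ε))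
      = 4 * B₃ * A₁ / A₀ * ε + (B₃ * (30 * d ^ 2 * L ^ 2 * B₃ * (1 + β₀) * ε)) * Real.exp (-(2 * δ * M₂ * R)) := by
    ring
  have e2 : (4 * B₃ * A₁ / A₀ + 30 * d ^ 2 * L ^ 2 * B₃ ^ 2 * (1 + β₀) * Real.exp (-R)) * ε
      = 4 * B₃ * A₁ / A₀ * ε + (B₃ * (30 * d ^ 2 * L ^ 2 * B₃ * (1 + β₀) * ε)) * Real.exp (-R) := by
    ring
  rw [e1, e2]
  linarith [mul_lt_mul_of_pos_left hexp (mul_pos hB hc)]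

/-- **(3.7) with the two numerical coefficients of its first member as PARAMETERS** (revision v4).  In print the
first member's *"4δ_k"* is justified (p. 266, quoted above) off the boundary layer from *"(1/i) log[V_k(V_{□′}^{(k)})⁻¹],
hence it can be bounded by 4δ_k"*, i.e. from (3.3) — whose supremum runs over `(□′^{~2})^{(k)*}`, the `*` REMOVING
the bonds `b₀(c)`, `c ∈ (□′^{~2})^{(k+1)}` ((1.9) and the explanation p. 247), while those bonds belong to `Γ_k`; on
them the same linearisation yields, to leading order, a coefficient `c(d,L) ≥ 2(2d+1)(L−1) + 2` (times
`1 + O(L²ε_k + dLδ_k)`) in place of `4` (cell GAPS.md C-adv5-92 (b): a located objection, class «constant misstated /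
step unprinted, NOT suspected-false»; the lower bound `c(d,L)` is the objector's hand derivation — NOT printed, NOT
asserted here; wording sharpened in v4.1 after the XREAD GAPS.md C-pv04g24-4, DOCFIX D-1).  The typed chain is INSENSITIVE to the
two numbers: for every real `c` and every `c′ ≥ 0`, the first member with `(c, c′)` in place of `(4, 30d²L²)` and the
correspondingly modified restriction give the conclusion that is USED, `|H_{k,□}| < (1/10)ε_k`; the printed chain is
the instance `(c, c′) = (4, 30d²L²)` (`ineq37_conclusion_of_coeff`).  Nothing printed is re-typed: `Ineq37Printed`,
`ineq37_scalar`, `ineq37_conclusion`, `ineq37Printed_of_first` above are v3's, byte-identical.  Scalar part: with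
`δ_k = (A₁/A₀)ε_k` and `2δM₂ ≥ 1` the bracket `(c·B₃A₁/A₀ + c′B₃²(1+β₀)e^{−R_k})ε_k` majorises the first member, and
the last `<` IS the restriction `h10` (cell SMALLNESS.md S-B14.17/18 with `4 ↦ c`, `30d²L² ↦ c′`). [folklore] -/
theorem ineq37_coeff_scalar (c c' B₃ A₀ A₁ δ M₂ R ε δk β₀ : ℝ) (hB : 0 ≤ B₃) (hε : 0 < ε) (hβ : 0 ≤ 1 + β₀)
    (hc' : 0 ≤ c') (hδk : δk = A₁ / A₀ * ε) (hM : 1 ≤ 2 * δ * M₂) (hR : 0 ≤ R)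
    (h10 : c * B₃ * A₁ / A₀ + c' * B₃ ^ 2 * (1 + β₀) * Real.exp (-R) < 1/10) :
    B₃ * (c * δk + Real.exp (-(2 * δ * M₂ * R)) * (c' * B₃ * (1 + β₀) * ε))
      ≤ (c * B₃ * A₁ / A₀ + c' * B₃ ^ 2 * (1 + β₀) * Real.exp (-R)) * ε
    ∧ (c * B₃ * A₁ / A₀ + c' * B₃ ^ 2 * (1 + β₀) * Real.exp (-R)) * ε < (1/10) * ε := by
  constructor
  · have hexp : Real.exp (-(2 * δ * M₂ * R)) ≤ Real.exp (-R) := by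
      apply Real.exp_le_exp.mpr; nlinarith
    have hc : 0 ≤ c' * B₃ * (1 + β₀) * ε := mul_nonneg (mul_nonneg (mul_nonneg hc' hB) hβ) hε.le
    rw [hδk]
    have e1 : B₃ * (c * (A₁ / A₀ * ε) + Real.exp (-(2 * δ * M₂ * R)) * (c' * B₃ * (1 + β₀) * ε))
        = c * B₃ * A₁ / A₀ * ε + (B₃ * (c' * B₃ * (1 + β₀) * ε)) * Real.exp (-(2 * δ * M₂ * R)) := by
      ring
    have e2 : (c * B₃ * A₁ / A₀ + c' * B₃ ^ 2 * (1 + β₀) * Real.exp (-R)) * ε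
        = c * B₃ * A₁ / A₀ * ε + (B₃ * (c' * B₃ * (1 + β₀) * ε)) * Real.exp (-R) := by
      ring
    rw [e1, e2]
    linarith [mul_le_mul_of_nonneg_left hexp (mul_nonneg hB hc)]
  · exact mul_lt_mul_of_pos_right h10 hε

/-- (3.7) with parametrised coefficients, assembled: the first member with `(c, c′)` and the restrictions give
`|H_{k,□}| < (1/10)ε_k`.  E.g. any `c ≥ 2(2d+1)(L−1) + 2` (the leading-order LOWER bound of the reading of cell
GAPS.md C-adv5-92 (b)), `c′ = 30d²L²`, under the restriction `c·B₃A₁/A₀ + 30d²L²B₃²(1+β₀)e^{−R_k} < 1/10` — `d`, `L`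
(hence `c`) are fixed before `A₁/A₀` is chosen (p. 266: *"for A₁/A₀ and γ sufficiently small"*). [folklore] -/
theorem ineq37_coeff_conclusion (h c c' B₃ A₀ A₁ δ M₂ R ε δk β₀ : ℝ) (hB : 0 ≤ B₃) (hε : 0 < ε)
    (hβ : 0 ≤ 1 + β₀) (hc' : 0 ≤ c') (hδk : δk = A₁ / A₀ * ε) (hM : 1 ≤ 2 * δ * M₂) (hR : 0 ≤ R)
    (h10 : c * B₃ * A₁ / A₀ + c' * B₃ ^ 2 * (1 + β₀) * Real.exp (-R) < 1/10)
    (hfirst : h ≤ B₃ * (c * δk + Real.exp (-(2 * δ * M₂ * R)) * (c' * B₃ * (1 + β₀) * ε))) :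
    h < (1/10) * ε := by
  obtain ⟨h1, h2⟩ := ineq37_coeff_scalar c c' B₃ A₀ A₁ δ M₂ R ε δk β₀ hB hε hβ hc' hδk hM hR h10
  linarith

/-- The printed chain is the instance `(c, c′) = (4, 30d²L²)`: the statement of `ineq37_conclusion` re-derived from
`ineq37_coeff_conclusion` (compatibility check; v3's direct proof is kept above). [folklore] -/
theorem ineq37_conclusion_of_coeff (h B₃ A₀ A₁ δ M₂ R ε δk β₀ d L : ℝ) (hB : 0 ≤ B₃) (hε : 0 < ε)
    (hβ : 0 ≤ 1 + β₀) (hδk : δk = A₁ / A₀ * ε) (hM : 1 ≤ 2 * δ * M₂) (hR : 0 ≤ R)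
    (h10 : 4 * B₃ * A₁ / A₀ + 30 * d ^ 2 * L ^ 2 * B₃ ^ 2 * (1 + β₀) * Real.exp (-R) < 1/10)
    (hfirst : h ≤ B₃ * (4 * δk + Real.exp (-(2 * δ * M₂ * R)) * (30 * d ^ 2 * L ^ 2 * B₃ * (1 + β₀) * ε))) :
    h < (1/10) * ε :=
  ineq37_coeff_conclusion h 4 (30 * d ^ 2 * L ^ 2) B₃ A₀ A₁ δ M₂ R ε δk β₀ hB hε hβ (by positivity) hδk hM hR
    h10 hfirst


/-- **(3.8)**, verbatim (p. 266 [PDF 24]): *"|U_{k,□}(∂p) − 1| < (1 + (2/10)ε_kη) ε_{k+1}(L⁻¹η)² + (2/10)ε_kη²(1 + (4/10)ε_k)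
< 2(1+β₀)L⁻²ε_kη² + (4/10)ε_kη² < ε_kη² (3.8) for p ⊂ □̃."*  Typed for ONE real number `u` (the left-hand side at a
plaquette); `εk1 = ε_{k+1}`. [cite: Balaban1988Convergent, (3.8) p.266] -/
def Ineq38Printed (u εk εk1 η L β₀ : ℝ) : Prop :=
  u < (1 + (2/10) * εk * η) * εk1 * (L⁻¹ * η) ^ 2 + (2/10) * εk * η ^ 2 * (1 + (4/10) * εk) ∧
  (1 + (2/10) * εk * η) * εk1 * (L⁻¹ * η) ^ 2 + (2/10) * εk * η ^ 2 * (1 + (4/10) * εk)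
    < 2 * (1 + β₀) * L⁻¹ ^ 2 * εk * η ^ 2 + (4/10) * εk * η ^ 2 ∧
  2 * (1 + β₀) * L⁻¹ ^ 2 * εk * η ^ 2 + (4/10) * εk * η ^ 2 < εk * η ^ 2

/-- (3.8), scalar part: the second member from the flow inequality `ε_{k+1} ≤ (1+β₀)ε_k` ((2.7)-type) and `0 < ε_k ≤ 1`,
`0 < η ≤ 1`; the last member IS the restriction `2(1+β₀)L⁻² + 4/10 < 1` (SMALLNESS.md S-B14.14: automatic for L ≥ 13,
β₀ ≤ 1/2). [folklore] -/
theorem ineq38_scalar (ε ε' η L β₀ : ℝ) (hε : 0 < ε) (hε1 : ε ≤ 1) (hη : 0 < η) (hη1 : η ≤ 1) (hL : 0 < L)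
    (hε' : 0 < ε') (hflow : ε' ≤ (1 + β₀) * ε) :
    (1 + (2/10) * ε * η) * ε' * (L⁻¹ * η) ^ 2 + (2/10) * ε * η ^ 2 * (1 + (4/10) * ε)
      < 2 * (1 + β₀) * L⁻¹ ^ 2 * ε * η ^ 2 + (4/10) * ε * η ^ 2
    ∧ (2 * (1 + β₀) * L⁻¹ ^ 2 + 4/10 < 1 →
        2 * (1 + β₀) * L⁻¹ ^ 2 * ε * η ^ 2 + (4/10) * ε * η ^ 2 < ε * η ^ 2) := by
  have hLi : 0 < L⁻¹ := inv_pos.mpr hL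
  constructor
  · have h1 : (1 + (2/10) * ε * η) * ε' * (L⁻¹ * η) ^ 2 < 2 * (1 + β₀) * L⁻¹ ^ 2 * ε * η ^ 2 := by
      have ha : 1 + (2/10) * ε * η < 2 := by nlinarith
      have hb : 0 < ε' * (L⁻¹ * η) ^ 2 := by positivity
      calc (1 + (2/10) * ε * η) * ε' * (L⁻¹ * η) ^ 2
          = (1 + (2/10) * ε * η) * (ε' * (L⁻¹ * η) ^ 2) := by ring
        _ < 2 * (ε' * (L⁻¹ * η) ^ 2) := mul_lt_mul_of_pos_right ha hb
        _ ≤ 2 * (((1 + β₀) * ε) * (L⁻¹ * η) ^ 2) := by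
            have : 0 ≤ (L⁻¹ * η) ^ 2 := by positivity
            nlinarith [mul_le_mul_of_nonneg_right hflow this]
        _ = 2 * (1 + β₀) * L⁻¹ ^ 2 * ε * η ^ 2 := by ring
    have h2 : (2/10) * ε * η ^ 2 * (1 + (4/10) * ε) ≤ (4/10) * ε * η ^ 2 := by
      have : 1 + (4/10) * ε ≤ 2 := by linarith
      have hpos : 0 ≤ (2/10) * ε * η ^ 2 := by positivity
      nlinarith [mul_le_mul_of_nonneg_left this hpos]
    linarith
  · intro h
    have hpos : 0 < ε * η ^ 2 := by positivity
    have := mul_lt_mul_of_pos_right h hpos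
    linarith [this]

/-- (3.8) assembled: first printed member + flow inequality + restriction ⇒ `|U_{k,□}(∂p) − 1| < ε_k η²`, the form
used next — p. 266 [PDF 24], verbatim: *"Thus χ_k(□) = 1 for □ ⊂ Ω̃_{k+1}."* [folklore] -/
theorem ineq38_conclusion (u ε ε' η L β₀ : ℝ) (hε : 0 < ε) (hε1 : ε ≤ 1) (hη : 0 < η) (hη1 : η ≤ 1) (hL : 0 < L)
    (hε' : 0 < ε') (hflow : ε' ≤ (1 + β₀) * ε) (hrestr : 2 * (1 + β₀) * L⁻¹ ^ 2 + 4/10 < 1)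
    (hfirst : u < (1 + (2/10) * ε * η) * ε' * (L⁻¹ * η) ^ 2 + (2/10) * ε * η ^ 2 * (1 + (4/10) * ε)) :
    u < ε * η ^ 2 := by
  obtain ⟨h1, h2⟩ := ineq38_scalar ε ε' η L β₀ hε hε1 hη hη1 hL hε' hflow
  linarith [h2 hrestr]

/-- The chain (3.8) EXACTLY AS PRINTED holds given its first member, the flow inequality and the restriction. [folklore] -/
theorem ineq38Printed_of_first (u ε ε' η L β₀ : ℝ) (hε : 0 < ε) (hε1 : ε ≤ 1) (hη : 0 < η) (hη1 : η ≤ 1)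
    (hL : 0 < L) (hε' : 0 < ε') (hflow : ε' ≤ (1 + β₀) * ε) (hrestr : 2 * (1 + β₀) * L⁻¹ ^ 2 + 4/10 < 1)
    (hfirst : u < (1 + (2/10) * ε * η) * ε' * (L⁻¹ * η) ^ 2 + (2/10) * ε * η ^ 2 * (1 + (4/10) * ε)) :
    Ineq38Printed u ε ε' η L β₀ := by
  obtain ⟨h1, h2⟩ := ineq38_scalar ε ε' η L β₀ hε hε1 hη hη1 hL hε' hflow
  exact ⟨hfirst, h1, h2 hrestr⟩

/-- **(3.14)**, verbatim (p. 267 [PDF 25]): *"|V_k′ − 1| = |V_k − V^{(k)}| ≦ |V_k − V_{□′}^{(k)}| + |V_{□′}^{(k)} − V^{(k)}|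
< 2δ_k + (4dL)²(1+β₀)B₃ε_k = O(1)ε_k on □̃′"* — the triangle inequality in the bi-invariant group metric, with (3.3)
(small-field characteristic functions: `< 2δ_k`) and (3.13).  Typed over an abstract pseudo-metric space. [cite: Balaban1988Convergent, (3.14) p.267] -/
theorem ineq314_of {G : Type*} [PseudoMetricSpace G] (Vk Vbox Vk' : G) (δk εk d L β₀ B₃ : ℝ)
    (h1 : dist Vk Vbox < 2 * δk) (h2 : dist Vbox Vk' < (4 * d * L) ^ 2 * (1 + β₀) * B₃ * εk) :
    dist Vk Vk' < 2 * δk + (4 * d * L) ^ 2 * (1 + β₀) * B₃ * εk :=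
  lt_of_le_of_lt (dist_triangle Vk Vbox Vk') (by linarith)

/-- **(3.19)**, verbatim (p. 268 [PDF 26]): *"|V^{(k)}(b)(V_{□′}^{(k)}(b))⁻¹ − 1| < O(1)44d²B₃²(1+β₀)ε_k exp(−R_k) =
O(1)44d²B₃²(1+β₀)(A₀/A₁) exp(−R_k)δ_k < δ_k"*.  Scalar part: with `ε_k = (A₀/A₁)δ_k` the equality is an identity and
the last `<` IS the restriction `hsmall` (SMALLNESS.md S-B14.19; R_k ≥ (log g_k⁻²)^r beats A₀/A₁); `C` = the O(1).
[cite: Balaban1988Convergent, (3.19) p.268] -/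
theorem ineq319_scalar (C d B₃ β₀ A₀ A₁ R ε δ : ℝ) (hδ : 0 < δ) (hε : ε = A₀ / A₁ * δ)
    (hsmall : C * 44 * d ^ 2 * B₃ ^ 2 * (1 + β₀) * (A₀ / A₁) * Real.exp (-R) < 1) :
    C * 44 * d ^ 2 * B₃ ^ 2 * (1 + β₀) * ε * Real.exp (-R) < δ := by
  rw [hε]
  have := mul_lt_mul_of_pos_right hsmall hδ
  linarith [this]

/-- p. 269 [PDF 27], after (3.22), verbatim: *"we obtain that H^{(k)} is an analytic function of the background field
U_{k+1} restricted to Λ_{k+1}^c∩Λ_k, bounded on the set S_{k+1} by O(1)ε_k exp(−R_k), hence by any positive power of g_k."*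
(the bound itself is asserted — GAPS.md G-B14s-08).  The scalar implication "hence": with `R ≥ (log g⁻²)^r` (the sequence
R_j of Sect. 2) and `g` so small that `(log g⁻²)^{r−1} ≥ N`, `exp(−R) ≤ g^{2N}`. [folklore] -/
theorem exp_neg_R_le_pow (g R : ℝ) (r N : ℕ) (hg : 0 < g) (hg1 : g < 1) (hr : 1 ≤ r)
    (hR : (Real.log (g ^ 2)⁻¹) ^ r ≤ R) (hN : (N : ℝ) ≤ (Real.log (g ^ 2)⁻¹) ^ (r - 1)) :
    Real.exp (-R) ≤ g ^ (2 * N) := by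
  set ℓ := Real.log (g ^ 2)⁻¹ with hℓ
  have hg2 : 0 < g ^ 2 := by positivity
  have hℓpos : 0 < ℓ := by
    rw [hℓ]; apply Real.log_pos
    rw [one_lt_inv₀ hg2]
    nlinarith
  have h1 : (N : ℝ) * ℓ ≤ ℓ ^ r := by
    have : ℓ ^ r = ℓ ^ (r - 1) * ℓ := by
      rw [← pow_succ]; congr 1; omega
    rw [this]
    exact mul_le_mul_of_nonneg_right hN hℓpos.le
  have h2 : Real.exp (-R) ≤ Real.exp (-((N : ℝ) * ℓ)) := Real.exp_le_exp.mpr (by linarith)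
  have h3 : Real.exp (-((N : ℝ) * ℓ)) = g ^ (2 * N) := by
    rw [Real.exp_neg, Real.exp_nat_mul, hℓ, Real.exp_log (inv_pos.mpr hg2), inv_pow, inv_inv, ← pow_mul]
  rw [h3] at h2; exact h2

/-- **(3.48)**, verbatim (p. 280 [PDF 38]): *"very small by the bound (I.1.18): |𝐄^{(j)}(X, z)| ≦ E₀ exp(−κ(LʲL⁻ⁿ)⁻¹)
exp(−½κd_j(X)). (3.48)"* — from the inductive bound (I.1.18) `|𝐄^{(j)}(X,z)| ≤ E₀ exp(−κd_j(X))` for the domains X ∋ z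
not contained in □̃².  The scalar splitting: if `d_j(X) ≥ 2D` (`D = (LʲL⁻ⁿ)⁻¹`) then
`exp(−κd_j(X)) ≤ exp(−κD)·exp(−½κd_j(X))`. [folklore] -/
theorem exp_split_348 (κ dX D : ℝ) (hκ : 0 ≤ κ) (h : 2 * D ≤ dX) :
    Real.exp (-(κ * dX)) ≤ Real.exp (-(κ * D)) * Real.exp (-(κ * dX / 2)) := by
  rw [← Real.exp_add]; apply Real.exp_le_exp.mpr; nlinarith

/-- **(3.68)**, verbatim (p. 284 [PDF 42], in the sketched second proof of Theorem 2): *"|V′ − 1| < 11d²ε_n(LʲL⁻ⁿ)² +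
dM(n−j+2)ε_n(LʲL⁻ⁿ)² < 3dM(1 + log LʲL⁻ⁿ)ε_n(LʲL⁻ⁿ)², (3.68)"*.  Typed for ONE real `v`, `s = LʲL⁻ⁿ = L^j/L^n`.
AS PRINTED the logarithm is `log(L^j L^{-n}) = (j − n) log L ≤ 0` (j ≤ n) — see `ineq368_printed_fails`; the intended
`log(LⁿL⁻ʲ)` gives `ineq368_corrected` (cell DIVERGENCE.md D-pv02.10). [cite: Balaban1988Convergent, (3.68) p.284] -/
def Ineq368Printed (v d M L εn : ℝ) (j n : ℕ) : Prop :=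
  v < 11 * d ^ 2 * εn * (L ^ j / L ^ n) ^ 2 + d * M * ((n : ℝ) - j + 2) * εn * (L ^ j / L ^ n) ^ 2 ∧
  11 * d ^ 2 * εn * (L ^ j / L ^ n) ^ 2 + d * M * ((n : ℝ) - j + 2) * εn * (L ^ j / L ^ n) ^ 2
    < 3 * d * M * (1 + Real.log (L ^ j / L ^ n)) * εn * (L ^ j / L ^ n) ^ 2

/-- (3.68) with the intended `log (Lⁿ L⁻ʲ) = (n − j) log L`: `11d² + dM(n − j + 2) ≤ 3dM(1 + (n − j) log L)`
whenever `M ≥ 11d` and `log L ≥ 1/3` (so for every `L ≥ 2`); SMALLNESS.md S-B14.26. [folklore] -/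
theorem ineq368_corrected (d M logL : ℝ) (j n : ℕ) (hd : 0 < d) (hM : 11 * d ≤ M) (hL : 1/3 ≤ logL)
    (hjn : j ≤ n) :
    11 * d ^ 2 + d * M * ((n : ℝ) - j + 2) ≤ 3 * d * M * (1 + ((n : ℝ) - j) * logL) := by
  have hm : (0 : ℝ) ≤ (n : ℝ) - j := by
    have : (j : ℝ) ≤ n := by exact_mod_cast hjn
    linarith
  have hMpos : 0 < M := by linarith
  nlinarith [mul_nonneg (mul_nonneg hd.le hMpos.le) hm, mul_nonneg hd.le hMpos.le]

/-- (3.68) AS PRINTED (`… < 3dM(1 + log (LʲL⁻ⁿ))`, after division by `ε_n(LʲL⁻ⁿ)² > 0`) fails: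
`d = 1, M = 11, L = 2, j = 0, n = 1`. [folklore] -/
theorem ineq368_printed_fails :
    ¬ ∀ (d M L : ℝ) (j n : ℕ), 0 < d → 11 * d ≤ M → 2 ≤ L → j ≤ n →
      11 * d ^ 2 + d * M * ((n : ℝ) - j + 2) < 3 * d * M * (1 + Real.log (L ^ j / L ^ n)) := by
  intro h
  have := h 1 11 2 0 1 one_pos (by norm_num) le_rfl (by norm_num)
  have hlog : Real.log ((2:ℝ) ^ 0 / 2 ^ 1) = -Real.log 2 := by
    rw [pow_zero, pow_one, Real.log_div one_ne_zero two_ne_zero, Real.log_one, zero_sub]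
  rw [hlog] at this
  have h2 : 0 < Real.log 2 := Real.log_pos (by norm_num)
  push_cast at this
  linarith

end ScalarChains

/-! ## B. (3.49) + (3.55) ⇒ (3.56): antisymmetrization over the two index pairs (any dimension d) -/

section Antisymmetrization

variable {d : ℕ}

/-- One-pair antisymmetrization: `Σ_{μ,κ} f μ κ · g κ μ = Σ_{κ<μ} f μ κ · (g κ μ − g μ κ)` for `f` antisymmetric
(indicator form: the restricted sum is written over `univ` with `if κ < μ`). [folklore] -/
theorem sum_antisymm_pair (f g : Fin d → Fin d → ℝ) (hf : ∀ μ κ, f μ κ = -f κ μ) :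
    ∑ μ, ∑ κ, f μ κ * g κ μ = ∑ μ, ∑ κ, (if κ < μ then f μ κ * (g κ μ - g μ κ) else 0) := by
  set h : Fin d → Fin d → ℝ := fun μ κ => f μ κ * (g κ μ - g μ κ) with hh
  have hsym : ∀ μ κ, h κ μ = h μ κ := by
    intro μ κ; simp only [hh]; rw [hf κ μ]; ring
  have hdiag : ∀ μ, h μ μ = 0 := by intro μ; simp only [hh]; ring
  -- 2 S = Σ h
  have hneg : ∑ μ, ∑ κ, f κ μ * g μ κ = -∑ μ, ∑ κ, f μ κ * g μ κ := by
    rw [← Finset.sum_neg_distrib]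
    refine Finset.sum_congr rfl fun μ _ => ?_
    rw [← Finset.sum_neg_distrib]
    refine Finset.sum_congr rfl fun κ _ => ?_
    rw [hf κ μ]; ring
  have hswap : ∑ μ, ∑ κ, f μ κ * g κ μ = ∑ μ, ∑ κ, f κ μ * g μ κ := Finset.sum_comm
  have h2S : 2 * (∑ μ, ∑ κ, f μ κ * g κ μ) = ∑ μ, ∑ κ, h μ κ := by
    have : ∑ μ, ∑ κ, h μ κ = (∑ μ, ∑ κ, f μ κ * g κ μ) - ∑ μ, ∑ κ, f μ κ * g μ κ := by
      rw [← Finset.sum_sub_distrib]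
      refine Finset.sum_congr rfl fun μ _ => ?_
      rw [← Finset.sum_sub_distrib]
      refine Finset.sum_congr rfl fun κ _ => ?_
      simp only [hh]; ring
    rw [this, two_mul]
    nth_rewrite 2 [hswap]
    rw [hneg]; ring
  -- Σ h = 2 Σ_{κ<μ} h
  have hpt : ∀ μ κ, h μ κ = ((if κ < μ then h μ κ else 0) + (if μ < κ then h μ κ else 0))
      + (if μ = κ then h μ κ else 0) := by
    intro μ κ
    rcases lt_trichotomy κ μ with hlt | heq | hgt
    · simp [hlt, not_lt.mpr hlt.le, hlt.ne']
    · subst heq; simp [hdiag]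
    · simp [hgt, not_lt.mpr hgt.le, hgt.ne]
  have hA : ∑ μ, ∑ κ, h μ κ
      = (∑ μ, ∑ κ, (if κ < μ then h μ κ else 0)) + (∑ μ, ∑ κ, (if μ < κ then h μ κ else 0))
        + ∑ μ, ∑ κ, (if μ = κ then h μ κ else 0) := by
    simp only [← Finset.sum_add_distrib]
    refine Finset.sum_congr rfl fun μ _ => Finset.sum_congr rfl fun κ _ => hpt μ κ
  have hC : ∑ μ, ∑ κ, (if μ = κ then h μ κ else 0) = 0 := by
    have : ∀ μ : Fin d, ∑ κ, (if μ = κ then h μ κ else 0) = h μ μ := by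
      intro μ; rw [Finset.sum_ite_eq]; simp
    simp [this, hdiag]
  have hB : ∑ μ, ∑ κ, (if μ < κ then h μ κ else 0) = ∑ μ, ∑ κ, (if κ < μ then h μ κ else 0) := by
    rw [Finset.sum_comm]
    refine Finset.sum_congr rfl fun a _ => Finset.sum_congr rfl fun b _ => ?_
    rw [hsym a b]
  have hfin : ∑ μ, ∑ κ, f μ κ * g κ μ = ∑ μ, ∑ κ, (if κ < μ then h μ κ else 0) := by
    have := h2S; rw [hA, hB, hC] at this; linarith
  rw [hfin]

/-- Filter form of `sum_antisymm_pair`. [folklore] -/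
theorem sum_antisymm_pair' (f g : Fin d → Fin d → ℝ) (hf : ∀ μ κ, f μ κ = -f κ μ) :
    ∑ μ, ∑ κ, f μ κ * g κ μ = ∑ μ, ∑ κ ∈ univ.filter (· < μ), f μ κ * (g κ μ - g μ κ) := by
  rw [sum_antisymm_pair f g hf]
  refine Finset.sum_congr rfl fun μ _ => ?_
  rw [Finset.sum_filter]

/-- **(3.49) + (3.55) ⇒ (3.56)** (pp. 280–281 [PDF 38–39]), verbatim.  (3.49): *"Σ_{n=1}^{4} (1/n!) ⟨𝐄^{(n)}(X, z), ⊗ⁿB⟩ =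
Σ_{μ,ν,κ,λ} [Σ_{x,y} 𝐄^{(2)}_{μν}(X, x, y, z)(x_κ − z_κ)(y_λ − z_λ)] · ½ tr((∂_κB_μ)(z) + ½i[B_κ(z), B_μ(z)])((∂_λB_ν)(z) +
½i[B_λ(z), B_ν(z)]) + (the irrelevant terms)"*; p. 281: *"Denoting by 𝐄^{(2)}_{μν,κλ}(X, z) the sum over x, y in the square
bracket in (3.49), we have 𝐄^{(2)}_{μν,κλ}(X, z) = −𝐄^{(2)}_{κν,μλ}(X, z) = −𝐄^{(2)}_{μλ,κν}(X, z). (3.55) This property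
allows us to antisymmetrize the derivatives in (3.49) in the indices μ, κ and ν, λ. Denoting F_{κμ}(z) = (∂_κB_μ)(z) −
(∂_μB_κ)(z) + i[B_κ(z), B_μ(z)], we have Σ_{n=1}^{4} (1/n!) ⟨𝐄^{(n)}(X, z), ⊗ⁿB⟩ = Σ_{κ<μ, λ<ν} ½ 𝐄^{(2)}_{μν,κλ}(X, z) tr
F_{κμ}(z)F_{λν}(z) + (the irrelevant terms). (3.56)"*.  The algebraic skeleton, for ANY d and any coefficients:
`E μ ν κ τ` antisymmetric under `μ ↔ κ` and under `ν ↔ τ` ((3.55)), `T κ μ τ ν` arbitrary (standing for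
`½ tr(M_{κμ}M_{τν})`, `M_{κμ} = (∂_κB_μ)(z) + ½i[B_κ(z),B_μ(z)]`, so that `M_{κμ} − M_{μκ} = F_{κμ}`); then
`Σ_{μνκτ} E·T = Σ_{κ<μ, τ<ν} E·(T_{κμ,τν} − T_{μκ,τν} − T_{κμ,ντ} + T_{μκ,ντ})`, the bracket being `½ tr F_{κμ}F_{τν}` by
bilinearity of `(P,Q) ↦ ½ tr PQ`.  Indicator form (restricted sums written over `univ`). [cite: Balaban1988Convergent, (3.49) p.280, (3.55)–(3.56) p.281] -/
theorem sum_antisymm_two_pairs (E T : Fin d → Fin d → Fin d → Fin d → ℝ)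
    (hE₁ : ∀ μ ν κ τ, E μ ν κ τ = -E κ ν μ τ) (hE₂ : ∀ μ ν κ τ, E μ ν κ τ = -E μ τ κ ν) :
    ∑ μ, ∑ ν, ∑ κ, ∑ τ, E μ ν κ τ * T κ μ τ ν
      = ∑ μ, ∑ κ, ∑ ν, ∑ τ, (if κ < μ then (if τ < ν then
          E μ ν κ τ * (((T κ μ τ ν - T μ κ τ ν) - T κ μ ν τ) + T μ κ ν τ) else 0) else 0) := by
  -- Step 1: reorder to Σ_μ Σ_κ Σ_ν Σ_τ and antisymmetrize the inner (ν, τ) pair.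
  have step1 : ∀ μ κ, ∑ ν, ∑ τ, E μ ν κ τ * T κ μ τ ν
      = ∑ ν, ∑ τ, (if τ < ν then E μ ν κ τ * (T κ μ τ ν - T κ μ ν τ) else 0) := by
    intro μ κ
    exact sum_antisymm_pair (fun ν τ => E μ ν κ τ) (fun τ ν => T κ μ τ ν) (fun ν τ => hE₂ μ ν κ τ)
  have lhs1 : ∑ μ, ∑ ν, ∑ κ, ∑ τ, E μ ν κ τ * T κ μ τ ν
      = ∑ μ, ∑ κ, ∑ ν, ∑ τ, E μ ν κ τ * T κ μ τ ν := by
    refine Finset.sum_congr rfl fun μ _ => ?_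
    rw [Finset.sum_comm]
  rw [lhs1]
  have lhs2 : ∑ μ, ∑ κ, ∑ ν, ∑ τ, E μ ν κ τ * T κ μ τ ν
      = ∑ μ, ∑ κ, ∑ ν, ∑ τ, (if τ < ν then E μ ν κ τ * (T κ μ τ ν - T κ μ ν τ) else 0) := by
    refine Finset.sum_congr rfl fun μ _ => Finset.sum_congr rfl fun κ _ => step1 μ κ
  rw [lhs2]
  -- Step 2: move (ν, τ) outside, antisymmetrize (μ, κ), move back.
  have comm4 : ∀ (X : Fin d → Fin d → Fin d → Fin d → ℝ),
      ∑ μ, ∑ κ, ∑ ν, ∑ τ, X μ κ ν τ = ∑ ν, ∑ τ, ∑ μ, ∑ κ, X μ κ ν τ := by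
    intro X
    have e1 : ∑ μ, ∑ κ, ∑ ν, ∑ τ, X μ κ ν τ = ∑ μ, ∑ ν, ∑ κ, ∑ τ, X μ κ ν τ := by
      refine Finset.sum_congr rfl fun μ _ => ?_; rw [Finset.sum_comm]
    have e2 : ∑ μ, ∑ ν, ∑ κ, ∑ τ, X μ κ ν τ = ∑ ν, ∑ μ, ∑ κ, ∑ τ, X μ κ ν τ := Finset.sum_comm
    have e3 : ∑ ν, ∑ μ, ∑ κ, ∑ τ, X μ κ ν τ = ∑ ν, ∑ μ, ∑ τ, ∑ κ, X μ κ ν τ := by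
      refine Finset.sum_congr rfl fun ν _ => Finset.sum_congr rfl fun μ _ => ?_; rw [Finset.sum_comm]
    have e4 : ∑ ν, ∑ μ, ∑ τ, ∑ κ, X μ κ ν τ = ∑ ν, ∑ τ, ∑ μ, ∑ κ, X μ κ ν τ := by
      refine Finset.sum_congr rfl fun ν _ => ?_; rw [Finset.sum_comm]
    rw [e1, e2, e3, e4]
  rw [comm4, comm4 (fun μ κ ν τ => (if κ < μ then (if τ < ν then
          E μ ν κ τ * (((T κ μ τ ν - T μ κ τ ν) - T κ μ ν τ) + T μ κ ν τ) else 0) else 0))]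
  refine Finset.sum_congr rfl fun ν _ => Finset.sum_congr rfl fun τ _ => ?_
  by_cases hτν : τ < ν
  · simp only [hτν, if_true]
    have := sum_antisymm_pair (fun μ κ => E μ ν κ τ) (fun κ μ => T κ μ τ ν - T κ μ ν τ)
      (fun μ κ => hE₁ μ ν κ τ)
    rw [this]
    refine Finset.sum_congr rfl fun μ _ => Finset.sum_congr rfl fun κ _ => ?_
    by_cases hκμ : κ < μ
    · simp only [hκμ, if_true]; ring
    · simp only [hκμ, if_false]
  · simp [hτν]

end Antisymmetrization

/-! ## C. (3.51)–(3.54) "because A is an arbitrary matrix"; (3.60) ⇒ (3.61); (3.62) first equality -/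

section Symmetry

variable {d : ℕ}

/-- **(3.51) from (3.52)–(3.54)** (pp. 280–281 [PDF 38–39]), verbatim.  (3.51): *"We prove the following antisymmetry
property Σ_x 𝐄^{(2)}_{μν}(X, x, y, z)(x_κ − z_κ) = −Σ_x 𝐄^{(2)}_{κν}(X, x, y, z)(x_μ − z_μ). (3.51)"*; p. 281: *"Let us
suppress the other symbols and denote the left-hand side above by E_{μκ}. We decompose it into the symmetric and
antisymmetric parts … We have to prove that the symmetric part is equal to 0. Take the scalar product with an arbitrary
matrix A, tr AE^{(s)} = tr A^{(s)}E, where A^{(s)} is the symmetric part of A."* … (3.54): *"tr AE^{(s)} = Σ_{x,μ} (∂_μλ)(x)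
𝐄^{(2)}_{μν}(X, x, y, z) = 0 by the first identity (I.4.15). Because A is an arbitrary matrix, so the above equalities imply
E^{(s)} = 0, which is the property (3.51)."*  The linear-algebra skeleton of "because A is an arbitrary matrix": if the
pairing `Σ_{μ,κ} S_{μκ} M_{κμ}` vanishes for every SYMMETRIC `S`, then `M` is antisymmetric (test with
`S = e_{ab} + e_{ba}`).  The input (I.4.15) (first Ward–Takahashi identity of [I] Sect. 4) is NOT reproduced (GAPS.md
G-B14s-20). [cite: Balaban1988Convergent, (3.51)–(3.54) pp.280–281] -/
theorem antisymm_of_pairing_symm_zero (M : Fin d → Fin d → ℝ)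
    (h : ∀ S : Fin d → Fin d → ℝ, (∀ a b, S a b = S b a) → ∑ μ, ∑ κ, S μ κ * M κ μ = 0) :
    ∀ a b, M a b = -M b a := by
  intro a b
  let S : Fin d → Fin d → ℝ := fun μ κ =>
    (if μ = a then 1 else 0) * (if κ = b then 1 else 0) + (if μ = b then 1 else 0) * (if κ = a then 1 else 0)
  have hS : ∀ x y, S x y = S y x := by
    intro x y; simp only [S]; ring
  have := h S hS
  have hsum : ∑ μ, ∑ κ, S μ κ * M κ μ = M b a + M a b := by
    simp only [S, add_mul, Finset.sum_add_distrib, ite_mul, one_mul, zero_mul, mul_ite, mul_one, mul_zero]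
    simp [Finset.sum_ite_eq']
  rw [hsum] at this
  linarith

/-- The sign by which the reflection of the `α`-th coordinate axis acts on the vector index `i`.  Print (p. 282
[PDF 40]) uses the reflections through the matrix action on vector indices: *"On the right-hand side r denotes the
matrix of the corresponding rotation"*, *"For example, if r is the reflection in the hyperplane x_μ = 0, then
(rB)_μ(x) = … = −B_μ((…, −x_μ − 1, …))"*, and *"Considering reflections we conclude that in this case the
coefficients in the sum are different from 0 only if μ = ν and κ = λ"*; the diagonal sign matrix below is this
reader's encoding of a single axis reflection (v2: an earlier paraphrase set in quotation marks here was not a printed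
sentence — cell GAPS G-pv13-4 (4)). [folklore] -/
def axisSign (α i : Fin d) : ℝ := if i = α then -1 else 1

/-- (3.60) ⇒ (3.61), vanishing part: a rank-4 tensor invariant under all axis reflections vanishes at `(μ, ν, κ, τ)` with
`κ < μ`, `τ < ν` unless `μ = ν` and `κ = τ` (some index value occurs an odd number of times). [folklore] -/
theorem refl_invariant_vanish (P4 : Fin d → Fin d → Fin d → Fin d → ℝ)
    (hrefl : ∀ α μ ν κ τ, P4 μ ν κ τ = axisSign α μ * axisSign α ν * axisSign α κ * axisSign α τ * P4 μ ν κ τ)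
    {μ ν κ τ : Fin d} (hκμ : κ < μ) (hτν : τ < ν) (hne : ¬(μ = ν ∧ κ = τ)) : P4 μ ν κ τ = 0 := by
  by_cases hμν : μ = ν
  · -- then κ ≠ τ; the index κ occurs once
    have hκτ : κ ≠ τ := fun h => hne ⟨hμν, h⟩
    subst hμν
    have e := hrefl κ μ μ κ τ
    have h1 : axisSign κ μ = 1 := by simp [axisSign, hκμ.ne']
    have h2 : axisSign κ κ = -1 := by simp [axisSign]
    have h3 : axisSign κ τ = 1 := by simp [axisSign, hκτ.symm]
    rw [h1, h2, h3] at e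
    linarith
  · by_cases hμτ : μ = τ
    · -- μ = τ: the index κ occurs once (κ < μ = τ < ν)
      subst hμτ
      have hκν : κ ≠ ν := by
        intro h; subst h; exact lt_asymm hκμ hτν
      have e := hrefl κ μ ν κ μ
      have h1 : axisSign κ μ = 1 := by simp [axisSign, hκμ.ne']
      have h2 : axisSign κ κ = -1 := by simp [axisSign]
      have h3 : axisSign κ ν = 1 := by simp [axisSign, hκν.symm]
      rw [h1, h2, h3] at e
      linarith
    · -- μ occurs once
      have e := hrefl μ μ ν κ τ
      have h1 : axisSign μ μ = -1 := by simp [axisSign]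
      have h2 : axisSign μ ν = 1 := by simp [axisSign, Ne.symm hμν]
      have h3 : axisSign μ κ = 1 := by simp [axisSign, hκμ.ne]
      have h4 : axisSign μ τ = 1 := by simp [axisSign, Ne.symm hμτ]
      rw [h1, h2, h3, h4] at e
      linarith

/-- (3.60) ⇒ (3.61), diagonal part: a rank-4 tensor invariant under all coordinate permutations has all its entries
`P μ μ κ κ` (`κ ≠ μ`) equal (a permutation with `μ ↦ μ′`, `κ ↦ κ′` is built from two transpositions). [folklore] -/
theorem perm_invariant_diag (P4 : Fin d → Fin d → Fin d → Fin d → ℝ)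
    (hperm : ∀ σ : Equiv.Perm (Fin d), ∀ μ ν κ τ, P4 (σ μ) (σ ν) (σ κ) (σ τ) = P4 μ ν κ τ)
    {μ κ μ' κ' : Fin d} (h : κ ≠ μ) (h' : κ' ≠ μ') : P4 μ' μ' κ' κ' = P4 μ μ κ κ := by
  -- build σ with σ μ = μ', σ κ = κ'
  let s1 : Equiv.Perm (Fin d) := Equiv.swap μ μ'
  let s2 : Equiv.Perm (Fin d) := Equiv.swap (s1 κ) κ'
  let σ : Equiv.Perm (Fin d) := s1.trans s2
  have hμ : σ μ = μ' := by
    have e1 : s1 μ = μ' := Equiv.swap_apply_left μ μ'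
    have hne1 : μ' ≠ s1 κ := by
      intro hc
      have : κ = s1.symm μ' := (Equiv.apply_eq_iff_eq_symm_apply (f := s1)).mp hc.symm
      rw [Equiv.symm_swap, Equiv.swap_apply_right] at this
      exact h this
    show s2 (s1 μ) = μ'
    rw [e1]
    exact Equiv.swap_apply_of_ne_of_ne hne1 h'.symm
  have hκ : σ κ = κ' := by
    show s2 (s1 κ) = κ'
    exact Equiv.swap_apply_left _ _
  have := hperm σ μ μ κ κ
  rw [hμ, hκ] at this
  exact this

/-- **(3.60) ⇒ (3.61)**, verbatim (p. 282 [PDF 40]): *"((⊗⁴r)Π^{(j)})_{μν,κλ} = Π^{(j)}_{μν,κλ}. (3.60) Here r denotes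
the matrix of the Euclidean rotation r. This invariance has the usual implications, analyzed already in Sect. 5 [I]. Let
us describe them for the indices satisfying the restrictions κ < μ, λ < ν occurring in the sum (3.57). Considering
reflections we conclude that in this case the coefficients in the sum are different from 0 only if μ = ν and κ = λ.
Considering permutations we conclude that then they are all equal, e.g. they are equal to their values for μ = ν = 2,
κ = λ = 1. Thus we obtain (3.57) = β_j′ ½ Σ_{μ<ν} tr F²_{μν}(z), β_j′ = Π^{(j)}_{22,11}. (3.61)"*.  Typed: a rank-4 array
invariant under the axis reflections (`axisSign`: vector indices flip sign) and under the coordinate permutations equals,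
on `κ < μ`, `τ < ν`, `c·δ_{μν}δ_{κτ}` with the single constant `c = P μ₀ μ₀ κ₀ κ₀` for any fixed `κ₀ ≠ μ₀` (the print's
`Π^{(j)}_{22,11}`); any dimension d. [cite: Balaban1988Convergent, (3.60)–(3.61) p.282] -/
theorem invariant_tensor_361 (P4 : Fin d → Fin d → Fin d → Fin d → ℝ)
    (hrefl : ∀ α μ ν κ τ, P4 μ ν κ τ = axisSign α μ * axisSign α ν * axisSign α κ * axisSign α τ * P4 μ ν κ τ)
    (hperm : ∀ σ : Equiv.Perm (Fin d), ∀ μ ν κ τ, P4 (σ μ) (σ ν) (σ κ) (σ τ) = P4 μ ν κ τ)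
    {μ₀ κ₀ : Fin d} (h₀ : κ₀ ≠ μ₀) :
    ∀ μ ν κ τ, κ < μ → τ < ν →
      P4 μ ν κ τ = if (μ = ν ∧ κ = τ) then P4 μ₀ μ₀ κ₀ κ₀ else 0 := by
  intro μ ν κ τ hκμ hτν
  by_cases hc : μ = ν ∧ κ = τ
  · rw [if_pos hc]
    obtain ⟨h1, h2⟩ := hc
    subst h1; subst h2
    exact perm_invariant_diag P4 hperm h₀ hκμ.ne
  · rw [if_neg hc]
    exact refl_invariant_vanish P4 hrefl hκμ hτν hc

/-- **(3.62), first equality**, verbatim (p. 282 [PDF 40]): *"Using the translation invariance and the identity (I.4.15)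
again we have β_j′ = Σ_{x,y} Π^{(j)}_{22}(x, y, 0)x₁y₁ = −½ Σ_{x,y} Π^{(j)}_{22}(x, y, 0)(x₁ − y₁)² = …(3.62)"*.  What the
step uses is `x₁y₁ = −½(x₁−y₁)² + ½x₁² + ½y₁²` together with the vanishing of both marginals `Σ_y Π(x,y,0) = 0 = Σ_x Π(x,y,0)`
(the print's "(I.4.15) again", with a linear gauge function; NOT reproduced).  Typed over a finite index set with the two
vanishing marginals as hypotheses. [cite: Balaban1988Convergent, (3.62) p.282] -/
theorem beta_resum_362 {ι : Type*} [Fintype ι] (P : ι → ι → ℝ) (a : ι → ℝ)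
    (h1 : ∀ x, ∑ y, P x y = 0) (h2 : ∀ y, ∑ x, P x y = 0) :
    ∑ x, ∑ y, P x y * (a x * a y) = -(1/2 : ℝ) * ∑ x, ∑ y, P x y * (a x - a y) ^ 2 := by
  have hx : ∑ x, ∑ y, P x y * a x ^ 2 = 0 := by
    have : ∀ x, ∑ y, P x y * a x ^ 2 = (∑ y, P x y) * a x ^ 2 := by
      intro x; rw [Finset.sum_mul]
    simp [this, h1]
  have hy : ∑ x, ∑ y, P x y * a y ^ 2 = 0 := by
    rw [Finset.sum_comm]
    have : ∀ y, ∑ x, P x y * a y ^ 2 = (∑ x, P x y) * a y ^ 2 := by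
      intro y; rw [Finset.sum_mul]
    simp [this, h2]
  have hexp : ∑ x, ∑ y, P x y * (a x - a y) ^ 2
      = (∑ x, ∑ y, P x y * a x ^ 2) - 2 * (∑ x, ∑ y, P x y * (a x * a y)) + ∑ x, ∑ y, P x y * a y ^ 2 := by
    rw [Finset.mul_sum, ← Finset.sum_sub_distrib, ← Finset.sum_add_distrib]
    refine Finset.sum_congr rfl fun x _ => ?_
    rw [Finset.mul_sum, ← Finset.sum_sub_distrib, ← Finset.sum_add_distrib]
    refine Finset.sum_congr rfl fun y _ => ?_
    ring
  rw [hexp, hx, hy]; ring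

end Symmetry

/-! ## D. (3.35)–(3.37): resolvent identity and the `log det` integral (scalar instance; sign erratum); (3.40); p. 280 -/

section Resolvent

/-- **(3.36)**, verbatim (p. 274 [PDF 32]): *"− ½ log det(C*Δ^{(k)}C) = − ½ log λ₀ |Λ^{(k)*}_{k+1}| + ½ ∫₀^∞ dλ (λ₀ + λ)⁻¹
Tr(C*Δ^{(k)}C − λ₀I)(C*Δ^{(k)}C + λI)⁻¹. (3.36)"* (and (3.37) defines `𝐄₀^{(k+1)}(Λ_{k+1})` with the same "+½∫").
The 1×1 instance `C*Δ^{(k)}C = m > 0` is a computation: `∫₀^∞ (λ₀+t)⁻¹(m − λ₀)(m+t)⁻¹ dt = log m − log λ₀`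
(antiderivative `log((λ₀+t)/(m+t))`). [folklore] -/
theorem integral_resolvent_scalar (lam0 m : ℝ) (h0 : 0 < lam0) (hm : 0 < m) :
    ∫ t in Ioi (0:ℝ), (lam0 + t)⁻¹ * (m - lam0) * (m + t)⁻¹ = Real.log m - Real.log lam0 := by
  -- antiderivative F t = log (lam0 + t) - log (m + t)
  set F : ℝ → ℝ := fun t => Real.log (lam0 + t) - Real.log (m + t) with hF
  have hderiv : ∀ t ∈ Ici (0:ℝ), HasDerivAt F ((lam0 + t)⁻¹ * (m - lam0) * (m + t)⁻¹) t := by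
    intro t ht
    have ht' : (0:ℝ) ≤ t := ht
    have h1 : lam0 + t ≠ 0 := by linarith
    have h2 : m + t ≠ 0 := by linarith
    have d1 : HasDerivAt (fun s => Real.log (lam0 + s)) ((1:ℝ) / (lam0 + t)) t := by
      have := ((hasDerivAt_id t).const_add lam0).log h1
      simpa using this
    have d2 : HasDerivAt (fun s => Real.log (m + s)) ((1:ℝ) / (m + t)) t := by
      have := ((hasDerivAt_id t).const_add m).log h2
      simpa using this
    have d := d1.sub d2
    refine d.congr_deriv ?_
    field_simp
    ring
  have hlim : Tendsto F atTop (𝓝 0) := by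
    -- F t = log ((lam0+t)/(m+t)) for t ≥ 0, and (lam0+t)/(m+t) = 1 - (m-lam0)/(m+t) → 1
    have hq : Tendsto (fun t : ℝ => 1 - (m - lam0) / (m + t)) atTop (𝓝 1) := by
      have h3 : Tendsto (fun t : ℝ => m + t) atTop atTop :=
        tendsto_atTop_add_const_left atTop m tendsto_id
      have h4 : Tendsto (fun t : ℝ => (m - lam0) / (m + t)) atTop (𝓝 0) :=
        tendsto_const_nhds.div_atTop h3
      simpa using (tendsto_const_nhds (x := (1:ℝ))).sub h4
    have hlog : Tendsto (fun t : ℝ => Real.log (1 - (m - lam0) / (m + t))) atTop (𝓝 0) := by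
      have := (Real.continuousAt_log one_ne_zero).tendsto.comp hq
      rw [Real.log_one] at this
      exact this
    refine hlog.congr' ?_
    filter_upwards [eventually_ge_atTop (0:ℝ)] with t ht
    have h1 : 0 < lam0 + t := by linarith
    have h2 : 0 < m + t := by linarith
    have : 1 - (m - lam0) / (m + t) = (lam0 + t) / (m + t) := by
      field_simp; ring
    rw [this, Real.log_div h1.ne' h2.ne']
  rcases le_or_gt lam0 m with hle | hlt
  · have hpos : ∀ t ∈ Ioi (0:ℝ), 0 ≤ (lam0 + t)⁻¹ * (m - lam0) * (m + t)⁻¹ := by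
      intro t ht
      have ht' : (0:ℝ) < t := ht
      have h1 : 0 < lam0 + t := by linarith
      have h2 : 0 < m + t := by linarith
      have : 0 ≤ m - lam0 := by linarith
      positivity
    rw [integral_Ioi_of_hasDerivAt_of_nonneg' hderiv hpos hlim]
    simp [hF]
  · have hneg : ∀ t ∈ Ioi (0:ℝ), (lam0 + t)⁻¹ * (m - lam0) * (m + t)⁻¹ ≤ 0 := by
      intro t ht
      have ht' : (0:ℝ) < t := ht
      have h1 : 0 < lam0 + t := by linarith
      have h2 : 0 < m + t := by linarith
      have h3 : m - lam0 ≤ 0 := by linarith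
      have : 0 ≤ (lam0 + t)⁻¹ * (lam0 - m) * (m + t)⁻¹ := by
        have : 0 ≤ lam0 - m := by linarith
        positivity
      linarith [this]
    rw [integral_Ioi_of_hasDerivAt_of_nonpos' hderiv hneg hlim]
    simp [hF]

/-- Scalar form of (3.36) WITH THE CORRECTED SIGN "−½∫": `−½ log m = −½ log λ₀ − ½ ∫₀^∞ (λ₀+t)⁻¹(m−λ₀)(m+t)⁻¹ dt`
(for matrices: `−½ log det M = −½ log λ₀·dim − ½∫₀^∞ (λ₀+λ)⁻¹ Tr(M−λ₀)(M+λ)⁻¹ dλ`, eigenvalue by eigenvalue). [folklore] -/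
theorem logdet_scalar_336_corrected (lam0 m : ℝ) (h0 : 0 < lam0) (hm : 0 < m) :
    -(1/2 : ℝ) * Real.log m
      = -(1/2 : ℝ) * Real.log lam0 - (1/2 : ℝ) * ∫ t in Ioi (0:ℝ), (lam0 + t)⁻¹ * (m - lam0) * (m + t)⁻¹ := by
  rw [integral_resolvent_scalar lam0 m h0 hm]; ring

/-- The sign AS PRINTED in (3.36)/(3.37) ("+ ½ ∫₀^∞ …") fails already for 1×1 matrices (λ₀ = 1, m = e): cell
DIVERGENCE.md D-pv02.5 (print erratum; harmless — (3.36) and (3.37) carry the same sign and p. 280 uses only the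
absolute value of the bracket). [cite: Balaban1988Convergent, (3.36) p.274] -/
theorem logdet_scalar_336_printed_sign_fails :
    ¬ ∀ lam0 m : ℝ, 0 < lam0 → 0 < m →
      -(1/2 : ℝ) * Real.log m
        = -(1/2 : ℝ) * Real.log lam0 + (1/2 : ℝ) * ∫ t in Ioi (0:ℝ), (lam0 + t)⁻¹ * (m - lam0) * (m + t)⁻¹ := by
  intro h
  have := h 1 (Real.exp 1) one_pos (Real.exp_pos 1)
  rw [integral_resolvent_scalar 1 (Real.exp 1) one_pos (Real.exp_pos 1)] at this
  simp at this
  linarith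

/-- **(3.35)**, first identity, verbatim (p. 273 [PDF 31]): *"(C*Δ^{(k)}C − zI)⁻¹ = (λ₀ − z)⁻¹I − (λ₀ − z)⁻¹(C*Δ^{(k)}C −
λ₀I)(C*Δ^{(k)}C − zI)⁻¹"*.  Pure algebra in any ℂ-algebra: if `(M − z)R = 1` and `λ₀ ≠ z` then
`R = (λ₀−z)⁻¹(1 − (M−λ₀)R)`. [cite: Balaban1988Convergent, (3.35) p.273] -/
theorem resolvent_identity_335 {A : Type*} [Ring A] [Algebra ℂ A] (M R : A) (z lam0 : ℂ)
    (hR : (M - algebraMap ℂ A z) * R = 1) (hz : lam0 ≠ z) :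
    R = (lam0 - z)⁻¹ • (1 - (M - algebraMap ℂ A lam0) * R) := by
  have h1 : (M - algebraMap ℂ A lam0) * R = 1 - (lam0 - z) • R := by
    have : M - algebraMap ℂ A lam0 = (M - algebraMap ℂ A z) - algebraMap ℂ A (lam0 - z) := by
      rw [map_sub]; abel
    rw [this, sub_mul, hR, Algebra.algebraMap_eq_smul_one, smul_mul_assoc, one_mul]
  rw [h1, sub_sub_cancel, smul_smul, inv_mul_cancel₀ (sub_ne_zero.mpr hz), one_smul]

/-- p. 280 [PDF 38], verbatim: *"In the proof of Theorem 2 we simply estimate all these terms using the above bound, and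
the sum over X is bounded by O(1)exp(−κ(LʲL⁻ⁿ)⁻¹) ≦ O(1)(LʲL⁻ⁿ)⁵. This is an admissible error contributing only to the
constant on the right-hand side of (2.43)."*  The elementary inequality with its constant: `exp(−κu) ≤ (N/κ)^N e^{−N} u^{−N}`
for `κ, u > 0`, `N ≥ 1` (from `y ≤ e^{y−1}`). [folklore] -/
theorem exp_neg_mul_le_pow_inv (κ u : ℝ) (N : ℕ) (hκ : 0 < κ) (hu : 0 < u) (hN : 1 ≤ N) :
    Real.exp (-(κ * u)) ≤ ((N : ℝ) / κ) ^ N * Real.exp (-(N : ℝ)) * (u ^ N)⁻¹ := by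
  have hNpos : (0 : ℝ) < N := by exact_mod_cast hN
  set y : ℝ := κ * u / N with hy
  have hypos : 0 < y := by positivity
  -- y ≤ exp (y - 1)
  have h1 : y ≤ Real.exp (y - 1) := by
    have := Real.add_one_le_exp (y - 1); linarith
  have h2 : y ^ N ≤ Real.exp (y - 1) ^ N := pow_le_pow_left₀ hypos.le h1 N
  rw [← Real.exp_nat_mul] at h2
  have h3 : (N : ℝ) * (y - 1) = κ * u - N := by
    rw [hy]; field_simp
  rw [h3] at h2
  -- exp (-(κ u)) = exp(-N) * exp (-(κ u - N)) ≤ exp (-N) * (y^N)⁻¹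
  have h4 : Real.exp (-(κ * u - N)) ≤ (y ^ N)⁻¹ := by
    rw [Real.exp_neg]
    exact inv_anti₀ (pow_pos hypos N) h2
  have h5 : Real.exp (-(κ * u)) = Real.exp (-(N:ℝ)) * Real.exp (-(κ * u - N)) := by
    rw [← Real.exp_add]; congr 1; ring
  rw [h5]
  have h6 : (y ^ N)⁻¹ = ((N : ℝ) / κ) ^ N * (u ^ N)⁻¹ := by
    rw [hy, div_pow, div_pow, mul_pow]
    field_simp
  calc Real.exp (-(N:ℝ)) * Real.exp (-(κ * u - N))
      ≤ Real.exp (-(N:ℝ)) * (y ^ N)⁻¹ :=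
        mul_le_mul_of_nonneg_left h4 (Real.exp_pos _).le
    _ = ((N : ℝ) / κ) ^ N * Real.exp (-(N : ℝ)) * (u ^ N)⁻¹ := by rw [h6]; ring

/-- The form used on p. 280: with `s = LʲL⁻ⁿ > 0`, `exp(−κ/s) ≤ (5/κ)⁵e⁻⁵·s⁵` (so the "O(1)" is `(5/κ)⁵e⁻⁵`, κ-dependent).
[folklore] -/
theorem exp_neg_inv_le_pow_five (κ s : ℝ) (hκ : 0 < κ) (hs : 0 < s) :
    Real.exp (-(κ * s⁻¹)) ≤ ((5 : ℝ) / κ) ^ 5 * Real.exp (-(5 : ℝ)) * s ^ 5 := by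
  have := exp_neg_mul_le_pow_inv κ s⁻¹ 5 hκ (inv_pos.mpr hs) (by norm_num)
  simpa [inv_pow, inv_inv] using this

/-- **(3.40)**, verbatim (p. 275 [PDF 33]): *"Next we introduce functions h_z on the lattice T₁^{(k)}, for z ∈ T_L^{(k+1)}:
h_z(x) = Π_{μ=1}^{d} h(x_μ − z_μ), h(t) = max{1 − L⁻¹|t|, 0}. (3.40) They form a decomposition of unity: Σ_z h_z = 1."*
The one-dimensional tent of half-width `L`: `max(1 − |t|/L, 0)`. [cite: Balaban1988Convergent, (3.40) p.275] -/
noncomputable def tent (L t : ℝ) : ℝ := max (1 - |t| / L) 0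

/-- The tent vanishes outside `(−L, L)`. [folklore] -/
theorem tent_eq_zero_of_le (L t : ℝ) (hL : 0 < L) (h : L ≤ |t|) : tent L t = 0 := by
  unfold tent
  apply max_eq_right
  rw [sub_nonpos, le_div_iff₀ hL, one_mul]; exact h

/-- "They form a decomposition of unity: Σ_z h_z = 1" — one-dimensional factor: `Σ_{z∈ℤ} h(x − Lz) = 1` for every real
`x` (only the two translates `z = ⌊x/L⌋, ⌊x/L⌋+1` contribute); the d-dimensional identity is the product over the
coordinates (z running over the spacing-L lattice). [folklore] -/
theorem tent_partition_unity (L x : ℝ) (hL : 0 < L) : ∑' z : ℤ, tent L (x - L * z) = 1 := by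
  set m : ℤ := ⌊x / L⌋ with hm
  have hm1 : (m : ℝ) ≤ x / L := Int.floor_le _
  have hm2 : x / L < m + 1 := Int.lt_floor_add_one _
  have hx1 : L * m ≤ x := by rwa [le_div_iff₀ hL, mul_comm] at hm1
  have hx2 : x < L * (m + 1) := by rwa [div_lt_iff₀ hL, mul_comm] at hm2
  have hne : m ≠ m + 1 := by omega
  have hzero : ∀ z : ℤ, z ∉ ({m, m + 1} : Finset ℤ) → tent L (x - L * z) = 0 := by
    intro z hz
    simp only [Finset.mem_insert, Finset.mem_singleton, not_or] at hz
    apply tent_eq_zero_of_le L _ hL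
    rcases lt_or_gt_of_ne hz.1 with h | h
    · -- z ≤ m - 1
      have hz' : (z : ℝ) ≤ m - 1 := by exact_mod_cast (show z ≤ m - 1 by omega)
      have : L ≤ x - L * z := by nlinarith
      rw [abs_of_nonneg (by linarith)]; exact this
    · -- z ≥ m + 2
      have hz' : (m : ℝ) + 2 ≤ z := by exact_mod_cast (show m + 2 ≤ z by omega)
      have : L ≤ -(x - L * z) := by nlinarith
      rw [abs_of_nonpos (by linarith)]; exact this
  rw [tsum_eq_sum hzero, Finset.sum_pair hne]
  have e1 : tent L (x - L * m) = 1 - (x - L * m) / L := by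
    unfold tent; rw [abs_of_nonneg (by linarith)]
    apply max_eq_left
    rw [sub_nonneg, div_le_one hL]; linarith
  have e2 : tent L (x - L * ((m + 1 : ℤ) : ℝ)) = 1 - (L * (m + 1) - x) / L := by
    push_cast
    unfold tent; rw [abs_of_nonpos (by linarith)]
    rw [show -(x - L * ((m:ℝ) + 1)) = L * (m + 1) - x by ring]
    apply max_eq_left
    rw [sub_nonneg, div_le_one hL]; linarith
  rw [e1, e2]
  field_simp
  ring

end Resolvent

/-! ## E. (3.53): the gauge function λ and its lattice gradient -/

section Gauge353

variable {d : ℕ}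


/-- The `ν`-th coordinate unit vector `e_ν`. [folklore] -/
def bvec (ν : Fin d) : Fin d → ℝ := fun i => if i = ν then 1 else 0

/-- **(3.53)**, verbatim (p. 281 [PDF 39]): *"Take the function λ(x) = ½ Σ_{μ,κ} A^{(s)}_{μκ}(x_μ − z_μ)(x_κ − z_κ) −
Σ_μ A^{(s)}_{μμ}(x_μ − z_μ). (3.53) Of course (∂_μλ)(x) = Σ_κ A^{(s)}_{μκ}(x_κ − z_κ), hence"* (A^{(s)} the symmetric part
of the arbitrary d×d matrix A of (3.52); the ½ governs the first sum only).  Typed with a free linear coefficient `c`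
(printed `c = 1`), `u = x − z`. [cite: Balaban1988Convergent, (3.53) p.281] -/
noncomputable def lam353 (A : Fin d → Fin d → ℝ) (c : ℝ) (u : Fin d → ℝ) : ℝ :=
  (1/2 : ℝ) * ∑ μ, ∑ κ, A μ κ * u μ * u κ - c * ∑ μ, A μ μ * u μ

/-- Forward lattice difference quotient of `λ_c` in direction `ν` with spacing `ξ` (Bałaban's `∂_ν` is the forward
lattice derivative): for symmetric `A`, `ξ⁻¹ (λ_c(u + ξ e_ν) − λ_c(u)) = Σ_κ A_{νκ} u_κ + (ξ/2 − c) A_{νν}`. [folklore] -/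
theorem fwdDiff_lam353 (A : Fin d → Fin d → ℝ) (hA : ∀ μ κ, A μ κ = A κ μ) (c ξ : ℝ) (hξ : ξ ≠ 0)
    (u : Fin d → ℝ) (ν : Fin d) :
    ξ⁻¹ * (lam353 A c (u + ξ • bvec ν) - lam353 A c u) = ∑ κ, A ν κ * u κ + (ξ / 2 - c) * A ν ν := by
  unfold lam353
  have hsingle : ∀ i : Fin d, (u + ξ • bvec ν) i = u i + ξ * (if i = ν then 1 else 0) := by
    intro i; simp [bvec]
  simp only [hsingle]
  -- expand the quadratic form
  have e1 : ∑ μ, ∑ κ, (if μ = ν then A μ κ * u κ else 0) = ∑ κ, A ν κ * u κ := by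
    have : ∀ μ, ∑ κ, (if μ = ν then A μ κ * u κ else 0) = if μ = ν then ∑ κ, A μ κ * u κ else 0 := by
      intro μ; split_ifs <;> simp
    rw [Finset.sum_congr rfl (fun μ _ => this μ)]
    simp [Finset.sum_ite_eq']
  have e2 : ∑ μ, ∑ κ, (if κ = ν then A μ κ * u μ else 0) = ∑ κ, A ν κ * u κ := by
    have : ∀ μ, ∑ κ, (if κ = ν then A μ κ * u μ else 0) = A μ ν * u μ := by
      intro μ; simp [Finset.sum_ite_eq']
    simp only [this]
    exact Finset.sum_congr rfl (fun μ _ => by rw [hA μ ν])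
  have e3 : ∑ μ, ∑ κ, (if μ = ν then (if κ = ν then A μ κ else 0) else 0) = A ν ν := by
    have : ∀ μ, ∑ κ, (if μ = ν then (if κ = ν then A μ κ else 0) else 0) = if μ = ν then A μ ν else 0 := by
      intro μ; split_ifs <;> simp [Finset.sum_ite_eq']
    simp only [this]
    simp [Finset.sum_ite_eq']
  have hq : ∑ μ, ∑ κ, A μ κ * (u μ + ξ * (if μ = ν then 1 else 0)) * (u κ + ξ * (if κ = ν then 1 else 0))
      = ∑ μ, ∑ κ, A μ κ * u μ * u κ + 2 * ξ * ∑ κ, A ν κ * u κ + ξ ^ 2 * A ν ν := by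
    have hpt : ∀ μ κ, A μ κ * (u μ + ξ * (if μ = ν then 1 else 0)) * (u κ + ξ * (if κ = ν then 1 else 0))
        = A μ κ * u μ * u κ + (ξ * (if μ = ν then A μ κ * u κ else 0)
          + ξ * (if κ = ν then A μ κ * u μ else 0)) + ξ ^ 2 * (if μ = ν then (if κ = ν then A μ κ else 0) else 0) := by
      intro μ κ
      split_ifs <;> ring
    rw [Finset.sum_congr rfl fun μ _ => Finset.sum_congr rfl fun κ _ => hpt μ κ]
    simp only [Finset.sum_add_distrib, ← Finset.mul_sum]
    rw [e1, e2, e3]; ring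
  have hl : ∑ μ, A μ μ * (u μ + ξ * (if μ = ν then 1 else 0)) = ∑ μ, A μ μ * u μ + ξ * A ν ν := by
    have hpt : ∀ μ, A μ μ * (u μ + ξ * (if μ = ν then 1 else 0))
        = A μ μ * u μ + ξ * (if μ = ν then A μ μ else 0) := by
      intro μ; split_ifs <;> ring
    simp only [hpt, Finset.sum_add_distrib, ← Finset.mul_sum, Finset.sum_ite_eq', Finset.mem_univ, if_true]
  rw [hq, hl]
  field_simp
  ring

/-- With `c = ξ/2` (`= ½` on the unit lattice) the claimed *"(∂_μλ)(x) = Σ_κ A^{(s)}_{μκ}(x_κ − z_κ)"* holds exactly —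
which is all the argument (3.54) needs (existence of SOME λ with this gradient). [folklore] -/
theorem fwdDiff_lam353_half (A : Fin d → Fin d → ℝ) (hA : ∀ μ κ, A μ κ = A κ μ) (ξ : ℝ) (hξ : ξ ≠ 0)
    (u : Fin d → ℝ) (ν : Fin d) :
    ξ⁻¹ * (lam353 A (ξ / 2) (u + ξ • bvec ν) - lam353 A (ξ / 2) u) = ∑ κ, A ν κ * u κ := by
  rw [fwdDiff_lam353 A hA _ ξ hξ u ν]; ring

/-- With the PRINTED coefficient `c = 1` (unit lattice `ξ = 1`) the claimed gradient formula fails (d = 1, A = 1, u = 0,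
direction 0); cell DIVERGENCE.md D-pv02.7 (harmless misprint). [folklore] -/
theorem fwdDiff_lam353_printed_fails :
    ¬ ∀ (d : ℕ) (A : Fin d → Fin d → ℝ), (∀ μ κ, A μ κ = A κ μ) → ∀ (u : Fin d → ℝ) (ν : Fin d),
      (1:ℝ)⁻¹ * (lam353 A 1 (u + (1:ℝ) • bvec ν) - lam353 A 1 u) = ∑ κ, A ν κ * u κ := by
  intro h
  have := h 1 (fun _ _ => 1) (fun _ _ => rfl) (fun _ => 0) 0
  rw [fwdDiff_lam353 (fun _ _ => (1:ℝ)) (fun _ _ => rfl) 1 1 one_ne_zero] at this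
  simp at this
  norm_num at this

end Gauge353

/-! ## F. (3.67) ⇒ (2.43) and p. 283 ⇒ (2.44): the summation over points, landing in `B14Thm2.Ineq243/244` -/

section PointSums

/-- Summation bookkeeping behind "(3.67) ⇒ (2.43)": points `z ∈ Z` carry a scale `sc z = n ∈ [j, k]`
(`z ∈ Λ_j^0 ∩ (Ω_n ∖ Ω_{n+1})`), a per-point bound `|t z| ≤ c (L^{j−n})^a`, and the number of points of scale `n` is at most
`(L^{n−j})^4 Γ_n` (`|Γ_n ∩ Ω|` counted in `L^{-n}`-units, `d = 4`); then `|Σ_z t z| ≤ c Σ_{n=j}^{k} (L^{j−n})^{a−4} Γ_n`. [folklore] -/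
theorem pointSum_le {ι : Type*} (Z : Finset ι) (sc : ι → ℕ) (t : ι → ℝ) (j k : ℕ) (L c a : ℝ) (Γ : ℕ → ℝ)
    (hL : 0 < L) (hc : 0 ≤ c) (hsc : ∀ z ∈ Z, j ≤ sc z ∧ sc z ≤ k)
    (ht : ∀ z ∈ Z, |t z| ≤ c * (L ^ ((j : ℝ) - sc z)) ^ a)
    (hcount : ∀ n, ((Z.filter (fun z => sc z = n)).card : ℝ) ≤ (L ^ ((n : ℝ) - j)) ^ (4 : ℝ) * Γ n) :
    |∑ z ∈ Z, t z| ≤ c * ∑ n ∈ Finset.Icc j k, (L ^ ((j : ℝ) - n)) ^ (a - 4) * Γ n := by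
  have hmaps : ∀ z ∈ Z, sc z ∈ Finset.Icc j k := by
    intro z hz; rw [Finset.mem_Icc]; exact hsc z hz
  calc |∑ z ∈ Z, t z| ≤ ∑ z ∈ Z, |t z| := Finset.abs_sum_le_sum_abs _ _
    _ ≤ ∑ z ∈ Z, c * (L ^ ((j : ℝ) - sc z)) ^ a := Finset.sum_le_sum ht
    _ = ∑ n ∈ Finset.Icc j k, ∑ z ∈ Z.filter (fun z => sc z = n), c * (L ^ ((j : ℝ) - sc z)) ^ a := by
        rw [Finset.sum_fiberwise_of_maps_to hmaps]
    _ = ∑ n ∈ Finset.Icc j k, ((Z.filter (fun z => sc z = n)).card : ℝ) * (c * (L ^ ((j : ℝ) - n)) ^ a) := by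
        refine Finset.sum_congr rfl fun n _ => ?_
        have : ∑ z ∈ Z.filter (fun z => sc z = n), c * (L ^ ((j : ℝ) - sc z)) ^ a
            = ∑ z ∈ Z.filter (fun z => sc z = n), c * (L ^ ((j : ℝ) - n)) ^ a := by
          refine Finset.sum_congr rfl fun z hz => ?_
          rw [Finset.mem_filter] at hz
          rw [hz.2]
        rw [this, Finset.sum_const, nsmul_eq_mul]
    _ ≤ ∑ n ∈ Finset.Icc j k, ((L ^ ((n : ℝ) - j)) ^ (4 : ℝ) * Γ n) * (c * (L ^ ((j : ℝ) - n)) ^ a) := by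
        refine Finset.sum_le_sum fun n _ => ?_
        have hnn : 0 ≤ c * (L ^ ((j : ℝ) - n)) ^ a := by
          have : 0 ≤ (L ^ ((j : ℝ) - n)) ^ a := Real.rpow_nonneg (Real.rpow_nonneg hL.le _) _
          positivity
        exact mul_le_mul_of_nonneg_right (hcount n) hnn
    _ = c * ∑ n ∈ Finset.Icc j k, (L ^ ((j : ℝ) - n)) ^ (a - 4) * Γ n := by
        rw [Finset.mul_sum]
        refine Finset.sum_congr rfl fun n _ => ?_
        have hy : 0 < L ^ ((j : ℝ) - n) := Real.rpow_pos_of_pos hL _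
        have hinv : L ^ ((n : ℝ) - j) = (L ^ ((j : ℝ) - n))⁻¹ := by
          rw [← Real.rpow_neg hL.le]; congr 1; ring
        have key : (L ^ ((n : ℝ) - j)) ^ (4 : ℝ) * (L ^ ((j : ℝ) - n)) ^ a = (L ^ ((j : ℝ) - n)) ^ (a - 4) := by
          rw [hinv, Real.inv_rpow hy.le, ← Real.rpow_neg hy.le, ← Real.rpow_add hy]
          congr 1; ring
        calc (L ^ ((n : ℝ) - j)) ^ (4 : ℝ) * Γ n * (c * (L ^ ((j : ℝ) - n)) ^ a)
            = c * ((L ^ ((n : ℝ) - j)) ^ (4 : ℝ) * (L ^ ((j : ℝ) - n)) ^ a) * Γ n := by ring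
          _ = c * ((L ^ ((j : ℝ) - n)) ^ (a - 4) * Γ n) := by rw [key]; ring

/-- **(3.67)**, verbatim (p. 283 [PDF 41]): *"𝐄^{(j)}(Λ_j, U_k, z) − 𝐄^{(j)}(Λ_j, 1, z) − β_j A(h_z, U_k) = O((LʲL⁻ⁿ)^{5−β}),
(3.67) for z ∈ Λ_j⁰∩(Ω_n∖Ω_{n+1}), β > 0. Summing over z ∈ Λ_j⁰∩Ω w get the inequality (2.43) in Theorem 2 (with 1 − β, β > 0,
instead of β < 1)."* ("w" sic).  Typed as the REPRESENTATION HYPOTHESIS the summation consumes, over the cell's carrier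
`B14.Sect2Data`: for every `(j, k, ω)` the left-hand side `S.eTerm j k ω` of (2.43) is a finite sum of per-point terms
(the bracket of (3.67) after the resummation (3.65)–(3.66) of `β_j A(h_z,U_k)` into `β_j A(φ,U_k)`), each point carrying its
scale `n ∈ [j,k]`, each term bounded by `c (L^{j−n})^{5−β′}`, and at most `(L^{n−j})⁴ |Γ_n∩Ω|` points of scale `n`
(`Ω_n∖Ω_{n+1} ⊂ Γ_n` regionwise, d = 4, volumes in L⁻ⁿ-units as on p. 263).  This hypothesis is the CONTENT of pp. 278–283
and is not proved here. [cite: Balaban1988Convergent, (3.67) p.283] -/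
def Rep367 (S : B14.Sect2Data) (L c β' : ℝ) : Prop :=
  ∀ j k ω, 1 ≤ j → j ≤ k → k ≤ S.K →
    ∃ (Z : Finset ℕ) (sc : ℕ → ℕ) (t : ℕ → ℝ),
      S.eTerm j k ω = ∑ z ∈ Z, t z ∧ (∀ z ∈ Z, j ≤ sc z ∧ sc z ≤ k) ∧
      (∀ z ∈ Z, |t z| ≤ c * (L ^ ((j : ℝ) - sc z)) ^ (5 - β')) ∧
      (∀ n, ((Z.filter (fun z => sc z = n)).card : ℝ) ≤ (L ^ ((n : ℝ) - j)) ^ (4 : ℝ) * S.gammaVol n ω)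

/-- "(3.67) ⇒ (2.43)": under `Rep367`, (2.43) holds in the cell's typed form `B14Thm2.Ineq243` with exponent
`β = 1 − β′` and `E₁ = c` — exactly the printed "with 1 − β, β > 0, instead of β < 1". KERNEL-CHECKED summation;
the representation is the hypothesis. [folklore] -/
theorem ineq243_of_rep367 (S : B14.Sect2Data) (L c β' : ℝ) (hL : 0 < L) (hc : 0 ≤ c)
    (hrep : Rep367 S L c β') : B14Thm2.Ineq243 S L (1 - β') c := by
  intro j k ω hj hjk hkK
  obtain ⟨Z, sc, t, hsum, hsc, ht, hcount⟩ := hrep j k ω hj hjk hkK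
  rw [hsum]
  have := pointSum_le Z sc t j k L c (5 - β') (fun n => S.gammaVol n ω) hL hc hsc ht hcount
  have e : (5 : ℝ) - β' - 4 = 1 - β' := by ring
  rw [e] at this
  exact this

/-- p. 283 [PDF 41], last paragraph, verbatim: *"The inequality (2.44) for the functions 𝐑^{(j)} can be proved in an almost
identical way. We analyze these functions as above, but we stop at the identity (3.49), where 𝐄^{(2)}(X, x, y, z) is
replaced by 𝐑^{(2)}(X, x, y), and z is an arbitrary point from X. Now all the terms on the right-hand side can be bounded
by O(1)(LʲL⁻ⁿ)⁴ g_j^{κ₀} exp(−κd_j(X)), and this yields the inequality (2.44). The proof of Theorem 2 is completed."*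
Typed as the representation hypothesis for `S.rTerm`: per-point terms (the X-sum attached to a chosen point z(X) ∈ X∩Ω,
weighted by `Σ_{X∋z} exp(−κd_j(X)) ≤ O(1)`) bounded by `c g_j^{κ₀} (L^{j−n})⁴`, same point count.  NB: the printed bound
is PER DOMAIN X (termwise) — cell GAPS.md G-pv01-1(ii). [cite: Balaban1988Convergent, p.283] -/
def Rep244 (S : B14.Sect2Data) (L c : ℝ) (κ₀ : ℕ) : Prop :=
  ∀ j k ω, 1 ≤ j → j ≤ k → k ≤ S.K →
    ∃ (Z : Finset ℕ) (sc : ℕ → ℕ) (t : ℕ → ℝ),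
      S.rTerm j k ω = ∑ z ∈ Z, t z ∧ (∀ z ∈ Z, j ≤ sc z ∧ sc z ≤ k) ∧
      (∀ z ∈ Z, |t z| ≤ (c * (S.flow.g j) ^ κ₀) * (L ^ ((j : ℝ) - sc z)) ^ (4 : ℝ)) ∧
      (∀ n, ((Z.filter (fun z => sc z = n)).card : ℝ) ≤ (L ^ ((n : ℝ) - j)) ^ (4 : ℝ) * S.gammaVol n ω)

/-- "p. 283 ⇒ (2.44)": under `Rep244` (and `g_j ≥ 0`), (2.44) holds in the cell's typed form `B14Thm2.Ineq244` with
`R₁ = c`. KERNEL-CHECKED summation; the representation is the hypothesis. [folklore] -/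
theorem ineq244_of_rep244 (S : B14.Sect2Data) (L c : ℝ) (κ₀ : ℕ) (hL : 0 < L) (hc : 0 ≤ c)
    (hg : ∀ j, 0 ≤ S.flow.g j) (hrep : Rep244 S L c κ₀) : B14Thm2.Ineq244 S c κ₀ := by
  intro j k ω hj hjk hkK
  obtain ⟨Z, sc, t, hsum, hsc, ht, hcount⟩ := hrep j k ω hj hjk hkK
  rw [hsum]
  have hc' : 0 ≤ c * (S.flow.g j) ^ κ₀ := mul_nonneg hc (pow_nonneg (hg j) _)
  have := pointSum_le Z sc t j k L (c * (S.flow.g j) ^ κ₀) (4 : ℝ) (fun n => S.gammaVol n ω) hL hc' hsc ht hcount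
  have e : ∀ n : ℕ, (L ^ ((j : ℝ) - n)) ^ ((4 : ℝ) - 4) = 1 := by
    intro n; rw [sub_self, Real.rpow_zero]
  simp only [e, one_mul] at this
  exact this

/-- Bookkeeping: the two representation hypotheses deliver BOTH conjuncts of Theorem 2 for one run, in the typed form
of `B14Thm2` (`Ineq243 ∧ Ineq244`), with `E₁ = c`, `R₁ = c′`, `β = 1 − β′`. [folklore] -/
theorem thm2_conjuncts_of_reps (S : B14.Sect2Data) (L c c' β' : ℝ) (κ₀ : ℕ) (hL : 0 < L) (hc : 0 ≤ c)
    (hc' : 0 ≤ c') (hg : ∀ j, 0 ≤ S.flow.g j) (h367 : Rep367 S L c β') (h244 : Rep244 S L c' κ₀) :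
    B14Thm2.Ineq243 S L (1 - β') c ∧ B14Thm2.Ineq244 S c' κ₀ :=
  ⟨ineq243_of_rep367 S L c β' hL hc h367, ineq244_of_rep244 S L c' κ₀ hL hc' hg h244⟩

end PointSums


end Literature.MathematicalPhysics.QuantumFieldTheory.Balaban1983to89.B14Sect3
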